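import Literature.AlgebraicTopology.Homotopy.StdSimplexCW
import Literature.AlgebraicTopology.Homotopy.FibreBundlesCellsDirectSum
import Literature.AlgebraicTopology.SingularHomology.StdSimplexHorn
import Literature.AlgebraicTopology.SingularHomology.DeformationRetractPairs
import HarnessLib

/-!
# Künneth classes on `(Δˢ, ∂Δˢ) × F` without cross products, and their boundary formula

Topic `Literature/AlgebraicTopology/Homotopy`. E. H. Spanier, *Algebraic Topology* (1981), Ch. 9,
Sec. 2, proof of Lemma 14 and Thm. 15: with `ξₛ ∈ Hₛ(Δˢ, Δ̇ˢ)` the orientation class, Spanier uses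
the cross products `ξₛ × w ∈ H_{n+s}((Δˢ, Δ̇ˢ) × F)`, `w ∈ Hₙ(F)`, the Künneth theorem for the cell
("`ψ_*` is an isomorphism by the Künneth theorem", proof of Thm. 15 (a)) and the boundary formula
"`∂(ξₛ × w) = ∑ᵢ (-1)ⁱ (eⁱₛ × 1)_*(ξₛ₋₁ × w)`" (proof of Lemma 14 / Thm. 15 (b)). The tree has no
cross product; this file supplies substitutes built from exact sequences only:

* `Ξ F R m n : Hₙ(F; R) ⟶ H_{n+m}((Δᵐ, ∂Δᵐ) × F; R)` — defined by `Ξ₀ = (F ≅ Δ⁰ × F)` and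
  `Ξₘ₊₁ = (∂_{Λ₀})⁻¹ ∘ (E⁰)_* ∘ Ξₘ`, `∂_{Λ₀}` the boundary of the triple
  `(Δᵐ⁺¹ × F, ∂Δᵐ⁺¹ × F, Λ₀ × F)` (an isomorphism: the horn `Λ₀ × F` is a strong deformation
  retract, `isZero_horn`, `isIso_tripleδ_horn`) and `Eʲ : (Δᵐ, ∂Δᵐ) × F → (∂Δᵐ⁺¹, Λₖ) × F` the
  cofaces; **natural in the fibre** (`map_comp_Ξ`) and **isomorphisms** (`isIso_Ξ`, the single-cell
  Künneth theorem; from `isIso_map_E_horn`: `(Eᵏ)_* : H((Δᵐ, ∂Δᵐ) × F) ≅ H((∂Δᵐ⁺¹, Λₖ) × F)` by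
  excision of `{y_k ≥ ½}`, the deformation `y_k → 0` and the slice homeomorphism);
* `sum_map_E_bijective` — the face decomposition
  `⊕ⱼ H((Δᵐ, ∂Δᵐ) × F) ≅ H((∂Δᵐ⁺¹, (Δᵐ⁺¹)ᵐ⁻¹) × F)`, the tree's direct-sum theorem for bundles
  over CW complexes (`CellsDirectSum.directSum_map_ιCY_bijective`, Spanier 9.2 Lemma 2) applied to
  `pr₁ : Δᵐ⁺¹ × F → Δᵐ⁺¹` with the face CW structure of `StdSimplexCW.lean`, reindexed by cofaces;
* **`boundary_formula`** — `∂_sk (Ξₘ₊₁ w) = ∑ⱼ (-1)ʲ (Eʲ)_* (Ξₘ w)` in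
  `H_{n+m}((∂Δᵐ⁺¹, (Δᵐ⁺¹)ᵐ⁻¹) × F)`, and **`T_Ξ`** — the transpositions `(k k+1) × 𝟙` of the
  vertices act by `-1` on `Ξₘ₊₁`. Proof by induction on `m`, with no sign computed by hand: the
  face components `cf` of `D w = ∂_sk (Ξₘ₊₁ w)` satisfy `cf 0 = Ξₘ w` (definition), are detected by
  the horn projections (`proj_eq_eHorn_cf`), the transposed class `w'` (`Ξ w' = T (Ξ w)`) has
  `D w' = TG (D w)`; comparing at a face fixed by the transposition (the `0`-th or the last one,
  where the induction hypothesis applies: `eMap_zero_comp_TG_succ`, `eMap_last_comp_TG_zero`)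
  gives `w' = -w`, and comparing at the face `k+1` gives `cf (k+1) = - cf k`; the base `Δ¹` is
  `∂ ≫ incl = 0` plus the homotopy between the two vertex inclusions (`cf_D_one_base`).

Everything is proved; no named facts. Brick (γ2b) of the printed proof of
`Literature.AlgebraicTopology.Homotopy.Spanier1981_eulerChar_fibreBundle` (Spanier 9.3 Thm. 1 via
9.2 Thms. 13–16): the classes `Ξ` and `boundary_formula` are what the chain map `ψ` of Spanier 9.2
Thm. 13 (cellular singular chains `⊗ Hₙ(F) →` the `E¹` term) and Lemma 14 / Thm. 15 consume.

## References

* E. H. Spanier, *Algebraic Topology*, Springer (1981), Ch. 9, Sec. 2, Lemma 2, Thm. 13, Lemma 14,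
  Thm. 15. [Spanier1981]
* A. Hatcher, *Algebraic Topology*, CUP (2002), §2.1 (exact sequence of a triple, excision),
  §3.B (cross product; not used). [HatcherAT2002]
-/

noncomputable section

open Set Metric Topology unitInterval CategoryTheory CategoryTheory.Limits
open Literature.AlgebraicTopology.SingularHomology

universe w uR

namespace Literature.AlgebraicTopology.Homotopy

namespace SimplexTimesFibre

open RelCWComplex StdSimplexCW

variable (F : Type w) [TopologicalSpace F] (R : Type uR) [CommRing R]

/-! ### The pairs `(Δᵐ, ∂Δᵐ) × F`, the horns and the codimension-2 skeleton -/

/-- `∂Δᵐ × F ⊆ Δᵐ × F` (the boundary as the skeleton `skeletonLT m` of the face CW structure; in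
positive dimension literally `CellsDirectSum.tot Prod.fst (m - 1)`, the form of the direct-sum theorem).
[folklore] -/
abbrev bd : (m : ℕ) → Set (StdSimplex m × F)
  | 0 => Prod.fst ⁻¹' (skeletonLT (univ : Set (StdSimplex 0)) ((0 : ℕ) : ℕ∞) : Set (StdSimplex 0))
  | m + 1 => Prod.fst ⁻¹' (skeletonLT (univ : Set (StdSimplex (m + 1))) ((m : ℕ∞) + 1) : Set (StdSimplex (m + 1)))

/-- `(Δᵐ⁺¹)ᵐ⁻¹ × F ⊆ Δᵐ⁺¹ × F` (the codimension-2 skeleton). [folklore] -/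
abbrev sk (m : ℕ) : Set (StdSimplex (m + 1) × F) :=
  Prod.fst ⁻¹' (skeletonLT (univ : Set (StdSimplex (m + 1))) (m : ℕ∞) : Set (StdSimplex (m + 1)))

/-- `Λₖ × F ⊆ Δᵐ⁺¹ × F`, the `k`-th horn. [folklore] -/
abbrev horn {m : ℕ} (k : Fin (m + 2)) : Set (StdSimplex (m + 1) × F) := Prod.fst ⁻¹' stdHorn k

variable {F}

omit [TopologicalSpace F] in
/-- Membership in `∂Δᵐ × F`: some barycentric coordinate vanishes. [folklore] -/
theorem mem_bd_iff {m : ℕ} {x : StdSimplex m × F} : x ∈ bd F m ↔ ∃ i, (x.1 : Fin (m + 1) → ℝ) i = 0 := by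
  cases m with
  | zero => rw [bd, mem_preimage, skeletonLT_eq_stdBoundary, mem_stdBoundary_iff]
  | succ m =>
    rw [bd, mem_preimage, ← Nat.cast_succ, skeletonLT_eq_stdBoundary, mem_stdBoundary_iff]

omit [TopologicalSpace F] in
/-- Membership in the codimension-2 skeleton: at most `m` positive coordinates. [folklore] -/
theorem mem_sk_iff {m : ℕ} {x : StdSimplex (m + 1) × F} : x ∈ sk F m ↔ (StdSimplexCW.support x.1).card ≤ m := by
  rw [sk, mem_preimage, StdSimplexCW.mem_skeletonLT_iff]

omit [TopologicalSpace F] in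
/-- The horn lies in the boundary. [folklore] -/
theorem horn_subset_bd {m : ℕ} (k : Fin (m + 2)) : horn F k ⊆ bd F (m + 1) := fun x hx => by
  obtain ⟨i, -, hi⟩ := hx
  exact mem_bd_iff.2 ⟨i, hi⟩

omit [TopologicalSpace F] in
/-- The codimension-2 skeleton lies in every horn. [folklore] -/
theorem sk_subset_horn {m : ℕ} (k : Fin (m + 2)) : sk F m ⊆ horn F k := fun x hx => by
  rw [mem_sk_iff] at hx
  -- at most `m` positive coordinates among `m + 2`: two zeros, one of them `≠ k`
  by_contra h
  have h' : ∀ i, i ≠ k → (x.1 : Fin (m + 2) → ℝ) i ≠ 0 := fun i hi h0 => h ⟨i, hi, h0⟩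
  have hsub : Finset.univ.erase k ⊆ StdSimplexCW.support x.1 := fun i hi =>
    mem_support_iff.2 (h' i (Finset.mem_erase.1 hi).1)
  have := Finset.card_le_card hsub
  rw [Finset.card_erase_of_mem (Finset.mem_univ k), Finset.card_univ, Fintype.card_fin] at this
  omega

omit [TopologicalSpace F] in
/-- The codimension-2 skeleton lies in the boundary. [folklore] -/
theorem sk_subset_bd (m : ℕ) : sk F m ⊆ bd F (m + 1) := (sk_subset_horn 0).trans (horn_subset_bd 0)

/-! ### The coface maps `Eʲ : (Δᵐ, ∂Δᵐ) × F → (∂Δᵐ⁺¹, Λₖ) × F` -/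

/-- The coface `(z, v) ↦ (δⱼ z, v)` into `∂Δᵐ⁺¹ × F`. [folklore] -/
def E (F : Type w) [TopologicalSpace F] {m : ℕ} (j : Fin (m + 2)) : C(StdSimplex m × F, ↥(bd F (m + 1))) :=
  ⟨fun x => ⟨(stdFace j x.1, x.2), mem_bd_iff.2 ⟨j, stdFace_apply_self j x.1⟩⟩,
    (((stdFace j).continuous.comp continuous_fst).prodMk continuous_snd).subtype_mk _⟩

/-- `Eʲ` maps `∂Δᵐ × F` into every horn `Λₖ × F`. [folklore] -/
theorem mapsTo_E_horn {m : ℕ} (j k : Fin (m + 2)) :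
    MapsTo (E F j) (bd F m) (Subtype.val ⁻¹' horn F k) := fun x hx => by
  obtain ⟨l, hl⟩ := mem_bd_iff.1 hx
  by_cases hjk : j = k
  · refine ⟨j.succAbove l, ?_, ?_⟩
    · rw [← hjk]; exact Fin.succAbove_ne j l
    · show (stdFace j x.1 : Fin (m + 2) → ℝ) (j.succAbove l) = 0
      rw [stdFace_apply_succAbove, hl]
  · exact ⟨j, hjk, stdFace_apply_self j x.1⟩

/-- `Eʲ` maps `∂Δᵐ × F` into the codimension-2 skeleton. [folklore] -/
theorem mapsTo_E_sk {m : ℕ} (j : Fin (m + 2)) : MapsTo (E F j) (bd F m) (Subtype.val ⁻¹' sk F m) := fun x hx => by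
  obtain ⟨l, hl⟩ := mem_bd_iff.1 hx
  show ((stdFace j x.1, x.2) : StdSimplex (m + 1) × F) ∈ sk F m
  rw [mem_sk_iff]
  have hsub : StdSimplexCW.support (stdFace j x.1) ⊆ (Finset.univ.erase j).erase (j.succAbove l) := fun i hi => by
    rw [mem_support_iff] at hi
    refine Finset.mem_erase.2 ⟨fun h => hi ?_, Finset.mem_erase.2 ⟨fun h => hi ?_, Finset.mem_univ i⟩⟩
    · rw [h, stdFace_apply_succAbove, hl]
    · rw [h, stdFace_apply_self]
  have := Finset.card_le_card hsub
  rw [Finset.card_erase_of_mem (Finset.mem_erase.2 ⟨Fin.succAbove_ne j l, Finset.mem_univ _⟩),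
    Finset.card_erase_of_mem (Finset.mem_univ j), Finset.card_univ, Fintype.card_fin] at this
  simpa using this


/-! ### The horn `Λₖ × F` is a strong deformation retract of `Δᵐ⁺¹ × F`: `H_•((Δᵐ⁺¹, Λₖ) × F) = 0` -/

/-- The linear deformation `(t, (z, v)) ↦ ((1-t) z + t ρₖ z, v)` of `Δᵐ⁺¹ × F` onto the horn `Λₖ × F`
(`ρₖ = hornRetr k`, the tree's horn retraction). [folklore] -/
def hornDeform {m : ℕ} (k : Fin (m + 2)) : C(I × (StdSimplex (m + 1) × F), StdSimplex (m + 1) × F) :=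
  ⟨fun q => (⟨(1 - (q.1 : ℝ)) • (q.2.1 : Fin (m + 2) → ℝ) + (q.1 : ℝ) • (hornRetr k q.2.1 : Fin (m + 2) → ℝ),
      (convex_stdSimplex ℝ (Fin (m + 2))) q.2.1.2 (hornRetr k q.2.1).2 (by linarith [q.1.2.2]) q.1.2.1 (by ring)⟩, q.2.2), by
    refine (Continuous.subtype_mk ?_ _).prodMk (continuous_snd.comp continuous_snd)
    exact ((continuous_const.sub (continuous_subtype_val.comp continuous_fst)).smul
      (continuous_subtype_val.comp (continuous_fst.comp continuous_snd))).add
      ((continuous_subtype_val.comp continuous_fst).smul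
        (continuous_subtype_val.comp ((hornRetr k).continuous.comp (continuous_fst.comp continuous_snd))))⟩

/-- The deformation starts at the identity. [folklore] -/
theorem hornDeform_zero {m : ℕ} (k : Fin (m + 2)) (x : StdSimplex (m + 1) × F) : hornDeform (F := F) k (0, x) = x := by
  refine Prod.ext (Subtype.ext ?_) rfl
  show (1 - ((0 : I) : ℝ)) • (x.1 : Fin (m + 2) → ℝ) + ((0 : I) : ℝ) • (hornRetr k x.1 : Fin (m + 2) → ℝ) = x.1
  simp

/-- The deformation ends at the horn retraction. [folklore] -/
theorem hornDeform_one {m : ℕ} (k : Fin (m + 2)) (x : StdSimplex (m + 1) × F) :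
    hornDeform (F := F) k (1, x) = (hornRetr k x.1, x.2) := by
  refine Prod.ext (Subtype.ext ?_) rfl
  show (1 - ((1 : I) : ℝ)) • (x.1 : Fin (m + 2) → ℝ) + ((1 : I) : ℝ) • (hornRetr k x.1 : Fin (m + 2) → ℝ) = _
  have h1 : ((1 : I) : ℝ) = 1 := rfl
  rw [h1, sub_self, zero_smul, one_smul, zero_add]
  rfl

/-- The deformation ends in the horn. [folklore] -/
theorem hornDeform_one_mem {m : ℕ} (k : Fin (m + 2)) (x : StdSimplex (m + 1) × F) : hornDeform (F := F) k (1, x) ∈ horn F k := by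
  rw [hornDeform_one]
  exact hornRetr_mem_stdHorn k x.1

/-- The deformation fixes the horn. [folklore] -/
theorem hornDeform_of_mem {m : ℕ} (k : Fin (m + 2)) (t : I) {x : StdSimplex (m + 1) × F} (hx : x ∈ horn F k) :
    hornDeform (F := F) k (t, x) = x := by
  refine Prod.ext (Subtype.ext ?_) rfl
  show (1 - (t : ℝ)) • (x.1 : Fin (m + 2) → ℝ) + (t : ℝ) • (hornRetr k x.1 : Fin (m + 2) → ℝ) = x.1
  rw [hornRetr_eq_self hx]
  module

/-- **`H_q((Δᵐ⁺¹, Λₖ) × F) = 0`** for all `q` (the horn is a strong deformation retract). [folklore] -/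
theorem isZero_horn {m : ℕ} (k : Fin (m + 2)) (q : ℕ) :
    IsZero (relativeSingularHomology R R (StdSimplex (m + 1) × F) (horn F k) q) := by
  haveI := relativeSingularHomology.isIso_map_of_deformation R R (horn F k) (V := horn F k) (hornDeform k)
    (hornDeform_zero k) (hornDeform_one_mem k) (fun t x hx => hornDeform_of_mem k t hx)
    (fun t x hx => by rw [hornDeform_of_mem k t hx]; exact hx) q
  exact IsZero.of_iso (relativeSingularHomology.isZero_preimage_self R R (horn F k) q)
    (asIso (relativeSingularHomology.map R R (subsetIncl (horn F k))
      (relativeSingularHomology.mapsTo_subsetIncl_preimage (horn F k) (horn F k)) q)).symm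

/-- **The boundary of the triple `(Δᵐ⁺¹ × F, ∂Δᵐ⁺¹ × F, Λₖ × F)` is an isomorphism**
`H_{q+1}((Δᵐ⁺¹, ∂Δᵐ⁺¹) × F) ≅ H_q((∂Δᵐ⁺¹, Λₖ) × F)`. [folklore] -/
theorem isIso_tripleδ_horn {m : ℕ} (k : Fin (m + 2)) (q : ℕ) :
    IsIso (relativeSingularHomology.tripleδ R R (StdSimplex (m + 1) × F) (bd F (m + 1)) (horn F k) q) := by
  let LES := GradedLES.ofTriple R R (horn_subset_bd (F := F) k)
  have hB : ∀ j, IsZero (LES.B j) := isZero_horn R k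
  haveI : Mono (LES.d q) := (LES.exact₃ q).mono_g ((hB (q + 1)).eq_of_src _ _)
  haveI : Epi (LES.d q) := (LES.exact₁ q).epi_f ((hB q).eq_of_tgt _ _)
  exact isIso_of_mono_of_epi (LES.d q)

/-! ### The Künneth classes `Ξₘ : Hₙ(F) → H_{n+m}((Δᵐ, ∂Δᵐ) × F)` -/

/-- `F ≃ₜ Δ⁰ × F`. [folklore] -/
def prodZeroHomeomorph (F : Type w) [TopologicalSpace F] : F ≃ₜ StdSimplex 0 × F where
  toFun v := (default, v)
  invFun x := x.2
  left_inv _ := rfl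
  right_inv _ := Prod.ext (Subsingleton.elim _ _) rfl
  continuous_toFun := continuous_const.prodMk continuous_id
  continuous_invFun := continuous_snd

/-- `∂Δ⁰ = ∅`. [folklore] -/
instance isEmpty_bd_zero : IsEmpty ↥(bd F 0) :=
  ⟨fun x => by
    have h := mem_bd_iff.1 x.2
    obtain ⟨i, hi⟩ := h
    have := sum_coord x.1.1
    rw [Fin.sum_univ_one] at this
    rw [Fin.eq_zero i] at hi
    rw [hi] at this
    exact zero_ne_one this⟩

/-- **The Künneth classes** `Ξₘ : Hₙ(F; R) → H_{n+m}((Δᵐ, ∂Δᵐ) × F; R)`: `Ξ₀` is `F ≅ Δ⁰ × F`, and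
`Ξₘ₊₁ = (δ_{Λ₀})⁻¹ ∘ (E⁰)_* ∘ Ξₘ` (the coface into the horn pair, then the inverse boundary of the
triple `(Δᵐ⁺¹ × F, ∂Δᵐ⁺¹ × F, Λ₀ × F)`) — a cross-product-free substitute for `w ↦ ξₘ × w`
(Spanier 1981, Ch. 9 Sec. 2, before Lemma 14). [cite: Spanier1981, Ch. 9 Sec. 2 Thm. 13–Lemma 14] -/
def Ξ (F : Type w) [TopologicalSpace F] (R : Type uR) [CommRing R] :
    (m n : ℕ) → (singularHomology R R F n ⟶ relativeSingularHomology R R (StdSimplex m × F) (bd F m) (n + m))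
  | 0, n => singularHomology.map R R (prodZeroHomeomorph F : C(F, StdSimplex 0 × F)) n ≫
      relativeSingularHomology.ofAbsolute R R (StdSimplex 0 × F) (bd F 0) n
  | m + 1, n =>
      haveI := isIso_tripleδ_horn (F := F) R (m := m) 0 (n + m)
      Ξ F R m n ≫ relativeSingularHomology.map R R (E F 0) (mapsTo_E_horn 0 0) (n + m) ≫
        inv (relativeSingularHomology.tripleδ R R (StdSimplex (m + 1) × F) (bd F (m + 1)) (horn F 0) (n + m))


/-! ### Naturality in the fibre -/

section Naturality

variable {F' : Type w} [TopologicalSpace F']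

omit [TopologicalSpace F] in
/-- **Naturality of the boundary of a triple** under a map of triples. [folklore] -/
theorem tripleδ_naturality {X : Type w} [TopologicalSpace X] {X' : Type w} [TopologicalSpace X'] (f : C(X, X'))
    {A B : Set X} {A' B' : Set X'} (hA : MapsTo f A A')
    (hB : MapsTo (subsetRestrict f hA) (Subtype.val ⁻¹' B) (Subtype.val ⁻¹' B')) (k : ℕ) :
    relativeSingularHomology.map R R f hA (k + 1) ≫ relativeSingularHomology.tripleδ R R X' A' B' k =
      relativeSingularHomology.tripleδ R R X A B k ≫ relativeSingularHomology.map R R (subsetRestrict f hA) hB k := by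
  rw [relativeSingularHomology.tripleδ, relativeSingularHomology.tripleδ, Category.assoc,
    relativeSingularHomology.ofAbsolute_comp_map, ← Category.assoc,
    ← relativeSingularHomology.δ_naturality, Category.assoc]

/-- `𝟙 × g` as a map of the pairs `(Δᵐ, ∂Δᵐ) × F → (Δᵐ, ∂Δᵐ) × F'`. [folklore] -/
abbrev fibreMap (m : ℕ) (g : C(F, F')) : C(StdSimplex m × F, StdSimplex m × F') :=
  ContinuousMap.prodMap (ContinuousMap.id _) g

omit [TopologicalSpace F] [TopologicalSpace F'] in
/-- `𝟙 × g` preserves the boundary. [folklore] -/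
theorem mapsTo_fibreMap_bd [TopologicalSpace F] [TopologicalSpace F'] (m : ℕ) (g : C(F, F')) :
    MapsTo (fibreMap m g) (bd F m) (bd F' m) := fun x hx => by
  cases m with
  | zero => exact hx
  | succ m => exact hx

omit [TopologicalSpace F] [TopologicalSpace F'] in
/-- `𝟙 × g` preserves the horns. [folklore] -/
theorem mapsTo_fibreMap_horn [TopologicalSpace F] [TopologicalSpace F'] {m : ℕ} (k : Fin (m + 2)) (g : C(F, F')) :
    MapsTo (subsetRestrict (fibreMap (m + 1) g) (mapsTo_fibreMap_bd (m + 1) g))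
      (Subtype.val ⁻¹' horn F k) (Subtype.val ⁻¹' horn F' k) := fun _ hx => hx

/-- The coface maps commute with `𝟙 × g`. [folklore] -/
theorem E_comp_fibreMap {m : ℕ} (j : Fin (m + 2)) (g : C(F, F')) :
    (E F' j).comp (fibreMap m g) = (subsetRestrict (fibreMap (m + 1) g) (mapsTo_fibreMap_bd (m + 1) g)).comp (E F j) := by
  ext x <;> rfl

/-- **Naturality of the Künneth classes in the fibre**: `g_* ∘ Ξₘ = Ξₘ ∘ (𝟙 × g)_*`.
[cite: Spanier1981, Ch. 9 Sec. 2 Thm. 13–Lemma 14] -/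
theorem map_comp_Ξ (g : C(F, F')) : ∀ (m n : ℕ),
    singularHomology.map R R g n ≫ Ξ F' R m n =
      Ξ F R m n ≫ relativeSingularHomology.map R R (fibreMap m g) (mapsTo_fibreMap_bd m g) (n + m)
  | 0, n => by
    change singularHomology.map R R g n ≫ (singularHomology.map R R (prodZeroHomeomorph F' : C(F', StdSimplex 0 × F')) n ≫
        relativeSingularHomology.ofAbsolute R R (StdSimplex 0 × F') (bd F' 0) n) =
      (singularHomology.map R R (prodZeroHomeomorph F : C(F, StdSimplex 0 × F)) n ≫
        relativeSingularHomology.ofAbsolute R R (StdSimplex 0 × F) (bd F 0) n) ≫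
        relativeSingularHomology.map R R (fibreMap 0 g) (mapsTo_fibreMap_bd 0 g) n
    rw [Category.assoc, relativeSingularHomology.ofAbsolute_comp_map, ← Category.assoc, ← Category.assoc,
      ← singularHomology.map_comp, ← singularHomology.map_comp]
    rfl
  | m + 1, n => by
    haveI := isIso_tripleδ_horn (F := F) R (m := m) 0 (n + m)
    haveI := isIso_tripleδ_horn (F := F') R (m := m) 0 (n + m)
    show singularHomology.map R R g n ≫ (Ξ F' R m n ≫ relativeSingularHomology.map R R (E F' 0) (mapsTo_E_horn 0 0) (n + m) ≫
        inv (relativeSingularHomology.tripleδ R R (StdSimplex (m + 1) × F') (bd F' (m + 1)) (horn F' 0) (n + m))) =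
      (Ξ F R m n ≫ relativeSingularHomology.map R R (E F 0) (mapsTo_E_horn 0 0) (n + m) ≫
        inv (relativeSingularHomology.tripleδ R R (StdSimplex (m + 1) × F) (bd F (m + 1)) (horn F 0) (n + m))) ≫ _
    rw [← Category.assoc, map_comp_Ξ g m n, Category.assoc, Category.assoc, Category.assoc]
    congr 1
    -- `(E⁰)_*` is natural
    have hE : relativeSingularHomology.map R R (fibreMap m g) (mapsTo_fibreMap_bd m g) (n + m) ≫
        relativeSingularHomology.map R R (E F' 0) (mapsTo_E_horn 0 0) (n + m) =
        relativeSingularHomology.map R R (E F 0) (mapsTo_E_horn 0 0) (n + m) ≫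
          relativeSingularHomology.map R R (subsetRestrict (fibreMap (m + 1) g) (mapsTo_fibreMap_bd (m + 1) g))
            (mapsTo_fibreMap_horn 0 g) (n + m) := by
      rw [← relativeSingularHomology.map_comp, ← relativeSingularHomology.map_comp]
      exact relativeSingularHomology.map_congr R R (E_comp_fibreMap 0 g) _ _ _
    rw [← Category.assoc, hE, Category.assoc]
    congr 1
    -- the inverse boundaries are natural
    rw [IsIso.eq_inv_comp, ← Category.assoc, IsIso.comp_inv_eq]
    exact (tripleδ_naturality (R := R) (f := fibreMap (m + 1) g) (mapsTo_fibreMap_bd (m + 1) g)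
      (mapsTo_fibreMap_horn 0 g) (n + m)).symm

end Naturality


/-! ### The coface `Eᵏ : (Δᵐ, ∂Δᵐ) × F → (∂Δᵐ⁺¹, Λₖ) × F` induces isomorphisms -/

section FaceIso

variable {m : ℕ} (k : Fin (m + 2))

/-- The `k`-th coordinate on `∂Δᵐ⁺¹ × F`. [folklore] -/
abbrev coordK (y : ↥(bd F (m + 1))) : ℝ := (y.1.1 : Fin (m + 2) → ℝ) k

omit [TopologicalSpace F] in
/-- The `k`-th coordinate is continuous. [folklore] -/
theorem continuous_coordK [TopologicalSpace F] : Continuous (coordK (F := F) k) :=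
  (continuous_apply k).comp (continuous_subtype_val.comp (continuous_fst.comp continuous_subtype_val))

omit [TopologicalSpace F] in
/-- The `k`-th coordinate is non-negative. [folklore] -/
theorem coordK_nonneg [TopologicalSpace F] (y : ↥(bd F (m + 1))) : 0 ≤ coordK k y := coord_nonneg _ _

omit [TopologicalSpace F] in
/-- The `k`-th coordinate is at most `1`. [folklore] -/
theorem coordK_le_one [TopologicalSpace F] (y : ↥(bd F (m + 1))) : coordK k y ≤ 1 := by
  have h := sum_coord y.1.1
  have := Finset.single_le_sum (fun i _ => coord_nonneg y.1.1 i) (Finset.mem_univ k)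
  unfold coordK; linarith

omit [TopologicalSpace F] in
/-- A point of `∂Δᵐ⁺¹ × F` with positive `k`-th coordinate lies in the horn `Λₖ × F`. [folklore] -/
theorem mem_horn_of_coordK_pos [TopologicalSpace F] {y : ↥(bd F (m + 1))} (hy : 0 < coordK k y) : (y : StdSimplex (m + 1) × F) ∈ horn F k := by
  obtain ⟨i, hi⟩ := mem_bd_iff.1 y.2
  refine ⟨i, fun h => ?_, hi⟩
  subst h; unfold coordK at hy; linarith

/-- The pushing of the `k`-th coordinate to `0` (rescaling the others), at time `t`, on points with
`y_k < 1`: `y ↦ (y - t y_k e_k) / (1 - t y_k)`. [folklore] -/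
def pushFun (t : ℝ) (y : Fin (m + 2) → ℝ) : Fin (m + 2) → ℝ :=
  fun i => (1 - t * y k)⁻¹ * (y i - if i = k then t * y k else 0)

/-- The push keeps the simplex (for `y_k < 1`). [folklore] -/
theorem pushFun_mem {t : ℝ} (_ht0 : 0 ≤ t) (ht1 : t ≤ 1) {y : Fin (m + 2) → ℝ} (hy : y ∈ stdSimplex ℝ (Fin (m + 2)))
    (hyk : y k < 1) : pushFun k t y ∈ stdSimplex ℝ (Fin (m + 2)) := by
  have hpos : 0 < 1 - t * y k := by nlinarith [hy.1 k]
  refine ⟨fun i => ?_, ?_⟩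
  · unfold pushFun
    refine mul_nonneg (inv_nonneg.2 hpos.le) ?_
    split_ifs with h
    · rw [h]; nlinarith [hy.1 k]
    · linarith [hy.1 i]
  · unfold pushFun
    rw [← Finset.mul_sum, Finset.sum_sub_distrib, hy.2, Finset.sum_ite_eq' Finset.univ k, if_pos (Finset.mem_univ k)]
    exact inv_mul_cancel₀ hpos.ne'

/-- The `k`-th coordinate of the push. [folklore] -/
theorem pushFun_apply_k (t : ℝ) (y : Fin (m + 2) → ℝ) : pushFun k t y k = (1 - t * y k)⁻¹ * ((1 - t) * y k) := by
  unfold pushFun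
  rw [if_pos rfl]
  ring

/-- The other coordinates of the push. [folklore] -/
theorem pushFun_apply_of_ne (t : ℝ) (y : Fin (m + 2) → ℝ) {i : Fin (m + 2)} (hi : i ≠ k) :
    pushFun k t y i = (1 - t * y k)⁻¹ * y i := by
  simp [pushFun, hi]

/-- At time `0` the push is the identity. [folklore] -/
theorem pushFun_zero (y : Fin (m + 2) → ℝ) : pushFun k 0 y = y := by
  ext i; simp [pushFun]

/-- The push fixes the slice `y_k = 0`. [folklore] -/
theorem pushFun_of_apply_eq_zero (t : ℝ) {y : Fin (m + 2) → ℝ} (hy : y k = 0) : pushFun k t y = y := by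
  ext i; simp [pushFun, hy]

/-- The push is jointly continuous where `t y_k < 1`. [folklore] -/
theorem continuousOn_pushFun : ContinuousOn (fun q : ℝ × (Fin (m + 2) → ℝ) => pushFun k q.1 q.2)
    {q : ℝ × (Fin (m + 2) → ℝ) | q.1 * q.2 k < 1} := by
  refine continuousOn_pi.2 fun i => ?_
  have hc : ContinuousOn (fun q : ℝ × (Fin (m + 2) → ℝ) => (1 - q.1 * q.2 k)⁻¹)
      {q : ℝ × (Fin (m + 2) → ℝ) | q.1 * q.2 k < 1} := by
    refine ContinuousOn.inv₀ (Continuous.continuousOn ?_) fun q hq => ?_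
    · exact continuous_const.sub (continuous_fst.mul ((continuous_apply k).comp continuous_snd))
    · have : q.1 * q.2 k < 1 := hq
      linarith
  refine hc.mul (Continuous.continuousOn ?_)
  refine ((continuous_apply i).comp continuous_snd).sub ?_
  split_ifs
  · exact continuous_fst.mul ((continuous_apply k).comp continuous_snd)
  · exact continuous_const

/-- **`Eᵏ` induces isomorphisms `H_q((Δᵐ, ∂Δᵐ) × F) ≅ H_q((∂Δᵐ⁺¹, Λₖ) × F)`** (excise `y_k ≥ ½`, push
`y_k → 0` inside `y_k < ½`, and identify the slice `y_k = 0` with `Δᵐ × F` by `δₖ`; the analogue of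
`relativeSingularHomology.isIso_map_sliceOne` for simplices). [folklore] -/
theorem isIso_map_E_horn (q : ℕ) :
    IsIso (relativeSingularHomology.map R R (E F k) (mapsTo_E_horn (F := F) k k) q) := by
  -- ambient `Y = ∂Δᵐ⁺¹ × F`, relative part `A = Λₖ × F`, open piece `B = {y_k < ½}`
  set Y : Type w := ↥(bd F (m + 1))
  set A : Set Y := Subtype.val ⁻¹' horn F k with hA
  set B : Set Y := {y | coordK k y < 2⁻¹} with hB
  have hBopen : IsOpen B := isOpen_lt (continuous_coordK k) continuous_const
  have hcover : interior A ∪ interior B = univ := by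
    apply eq_univ_of_forall
    intro y
    by_cases hy : 0 < coordK k y
    · left
      rw [mem_interior]
      exact ⟨{y' | 0 < coordK k y'}, fun y' hy' => mem_horn_of_coordK_pos k hy',
        isOpen_lt continuous_const (continuous_coordK k), hy⟩
    · right
      rw [hBopen.interior_eq]
      show coordK k y < 2⁻¹
      linarith [coordK_nonneg k y]
  have hexc := relativeSingularHomology.isIso_map_of_interior_union_interior_holds R R Y A B hcover q
  -- the deformation inside `B` onto the slice `y_k = 0`
  set A₁ : Set ↥B := {b | coordK k b.1 = 0} with hA₁
  set V : Set ↥B := Subtype.val ⁻¹' A with hV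
  have hlt : ∀ (t : I) (b : ↥B), (t : ℝ) * coordK k b.1 < 1 := fun t b => by
    have hb : coordK k b.1 < 2⁻¹ := b.2
    nlinarith [t.2.1, t.2.2, coordK_nonneg k b.1]
  have hmem : ∀ (t : I) (b : ↥B), pushFun k t (b.1.1.1 : Fin (m + 2) → ℝ) ∈ stdSimplex ℝ (Fin (m + 2)) := fun t b =>
    pushFun_mem k t.2.1 t.2.2 b.1.1.1.2 (by have hb : coordK k b.1 < 2⁻¹ := b.2; unfold coordK at hb; linarith)
  have hbd : ∀ (t : I) (b : ↥B), ((⟨pushFun k t (b.1.1.1 : Fin (m + 2) → ℝ), hmem t b⟩ : StdSimplex (m + 1)), b.1.1.2) ∈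
      bd F (m + 1) := fun t b => by
    obtain ⟨i, hi⟩ := mem_bd_iff.1 b.1.2
    by_cases hik : i = k
    · subst hik
      have h0 : pushFun i t (b.1.1.1 : Fin (m + 2) → ℝ) = b.1.1.1 := pushFun_of_apply_eq_zero i t hi
      refine mem_bd_iff.2 ⟨i, ?_⟩
      show pushFun i t (b.1.1.1 : Fin (m + 2) → ℝ) i = 0
      rw [h0]; exact hi
    · refine mem_bd_iff.2 ⟨i, ?_⟩
      show pushFun k t (b.1.1.1 : Fin (m + 2) → ℝ) i = 0
      rw [pushFun_apply_of_ne k t _ hik, hi, mul_zero]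
  have hB' : ∀ (t : I) (b : ↥B), (⟨_, hbd t b⟩ : Y) ∈ B := fun t b => by
    have hb : (b.1.1.1 : Fin (m + 2) → ℝ) k < 2⁻¹ := b.2
    have h1' : (t : ℝ) * (b.1.1.1 : Fin (m + 2) → ℝ) k < 1 := hlt t b
    have h1 : 0 < 1 - (t : ℝ) * (b.1.1.1 : Fin (m + 2) → ℝ) k := by linarith
    have h2 : 0 ≤ (t : ℝ) * (b.1.1.1 : Fin (m + 2) → ℝ) k := mul_nonneg t.2.1 (coord_nonneg _ _)
    show pushFun k t (b.1.1.1 : Fin (m + 2) → ℝ) k < 2⁻¹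
    rw [pushFun_apply_k, inv_mul_lt_iff₀ h1]
    nlinarith [t.2.1, t.2.2, coord_nonneg b.1.1.1 k]
  let H : C(I × ↥B, ↥B) :=
    ⟨fun q => ⟨⟨_, hbd q.1 q.2⟩, hB' q.1 q.2⟩, by
      refine Continuous.subtype_mk (Continuous.subtype_mk (Continuous.prodMk ?_ ?_) _) _
      · refine Continuous.subtype_mk ?_ _
        have hc := continuousOn_pushFun (m := m) k
        refine hc.comp_continuous ((continuous_subtype_val.comp continuous_fst).prodMk
          (continuous_subtype_val.comp (continuous_fst.comp (continuous_subtype_val.comp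
            (continuous_subtype_val.comp continuous_snd))))) fun q => ?_
        exact hlt q.1 q.2
      · exact continuous_snd.comp (continuous_subtype_val.comp (continuous_subtype_val.comp continuous_snd))⟩
  have hH0 : ∀ b, H (0, b) = b := fun b => by
    apply Subtype.ext; apply Subtype.ext
    refine Prod.ext (Subtype.ext ?_) rfl
    show pushFun k ((0 : I) : ℝ) (b.1.1.1 : Fin (m + 2) → ℝ) = _
    exact pushFun_zero k _
  have hH1 : ∀ b, H (1, b) ∈ A₁ := fun b => by
    show pushFun k ((1 : I) : ℝ) (b.1.1.1 : Fin (m + 2) → ℝ) k = 0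
    rw [pushFun_apply_k]
    show (1 - (1 : ℝ) * _)⁻¹ * ((1 - 1) * _) = 0
    ring
  have hHfix : ∀ (t : I), ∀ b ∈ A₁, H (t, b) = b := fun t b hb => by
    have hb' : coordK k b.1 = 0 := hb
    apply Subtype.ext; apply Subtype.ext
    refine Prod.ext (Subtype.ext ?_) rfl
    show pushFun k (t : ℝ) (b.1.1.1 : Fin (m + 2) → ℝ) = _
    exact pushFun_of_apply_eq_zero k t hb'
  have hHV : ∀ (t : I), ∀ b ∈ V, H (t, b) ∈ V := fun t b hb => by
    obtain ⟨i, hik, hi⟩ := hb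
    refine ⟨i, hik, ?_⟩
    show pushFun k (t : ℝ) (b.1.1.1 : Fin (m + 2) → ℝ) i = 0
    rw [pushFun_apply_of_ne k t _ hik]
    have : (b.1.1.1 : Fin (m + 2) → ℝ) i = 0 := hi
    rw [this, mul_zero]
  have hdef := relativeSingularHomology.isIso_map_of_deformation R R A₁ (V := V) H hH0 hH1 hHfix hHV q
  -- the slice `y_k = 0` is `Δᵐ × F`
  have hmemY : ∀ x : StdSimplex m × F, ((stdFace k x.1, x.2) : StdSimplex (m + 1) × F) ∈ bd F (m + 1) := fun x =>
    mem_bd_iff.2 ⟨k, stdFace_apply_self k x.1⟩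
  have hmemB : ∀ x : StdSimplex m × F, (⟨(stdFace k x.1, x.2), hmemY x⟩ : Y) ∈ B := fun x => by
    show (stdFace k x.1 : Fin (m + 2) → ℝ) k < 2⁻¹
    rw [stdFace_apply_self]; norm_num
  have hmemA₁ : ∀ x : StdSimplex m × F, (⟨⟨(stdFace k x.1, x.2), hmemY x⟩, hmemB x⟩ : ↥B) ∈ A₁ := fun x =>
    stdFace_apply_self k x.1
  -- the restriction of the slice to `Δᵐ`
  have hslice_mem : ∀ a : ↥A₁, a.1.1.1.1 ∈ closedFace (coface k) := fun a =>
    (mem_closedFace_coface_iff k).2 a.2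
  let e : StdSimplex m × F ≃ₜ ↥A₁ :=
    { toFun := fun x => ⟨⟨⟨(stdFace k x.1, x.2), hmemY x⟩, hmemB x⟩, hmemA₁ x⟩
      invFun := fun a => (faceRestr (coface k) a.1.1.1.1, a.1.1.1.2)
      left_inv := fun x => by
        refine Prod.ext ?_ rfl
        show faceRestr (coface k) (stdFace k x.1) = x.1
        rw [← faceMap_coface, faceRestr_faceMap]
      right_inv := fun a => by
        apply Subtype.ext; apply Subtype.ext; apply Subtype.ext
        refine Prod.ext ?_ rfl
        show stdFace k (faceRestr (coface k) a.1.1.1.1) = a.1.1.1.1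
        rw [← faceMap_coface, faceMap_faceRestr _ (hslice_mem a)]
      continuous_toFun := (((((stdFace k).continuous.comp continuous_fst).prodMk continuous_snd).subtype_mk _).subtype_mk _).subtype_mk _
      continuous_invFun := ((faceRestr (coface k)).continuous.comp (continuous_fst.comp (continuous_subtype_val.comp
        (continuous_subtype_val.comp continuous_subtype_val)))).prodMk
        (continuous_snd.comp (continuous_subtype_val.comp (continuous_subtype_val.comp continuous_subtype_val))) }
  have he : MapsTo e (bd F m) (Subtype.val ⁻¹' V) := fun x hx => mapsTo_E_horn k k hx
  have he' : MapsTo e.symm (Subtype.val ⁻¹' V) (bd F m) := fun a ha => by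
    obtain ⟨i, hik, hi⟩ := ha
    -- `i = k.succAbove l`, and the restriction has `l`-th coordinate `0`
    obtain ⟨l, rfl⟩ : ∃ l, k.succAbove l = i := by
      have : i ∈ Set.range k.succAbove := by rw [Fin.range_succAbove]; exact hik
      exact this
    refine mem_bd_iff.2 ⟨l, ?_⟩
    show (faceRestr (coface k) a.1.1.1.1 : Fin (m + 1) → ℝ) l = 0
    rw [faceRestr_apply_of_mem _ (hslice_mem a), coface_emb_apply]
    exact hi
  haveI := relativeSingularHomology.isIso_map_homeomorph R R e he he' q
  haveI := hdef
  haveI := hexc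
  have hfac : relativeSingularHomology.map R R (E F k) (mapsTo_E_horn (F := F) k k) q =
      relativeSingularHomology.map R R (e : C(StdSimplex m × F, ↥A₁)) he q ≫
        relativeSingularHomology.map R R (subsetIncl A₁)
          (relativeSingularHomology.mapsTo_subsetIncl_preimage A₁ V) q ≫
        relativeSingularHomology.map R R (X := ↥B) (subsetIncl B)
          (mapsTo_preimage Subtype.val A : MapsTo _ (Subtype.val ⁻¹' A) A) q := by
    rw [← relativeSingularHomology.map_comp, ← relativeSingularHomology.map_comp]
    exact relativeSingularHomology.map_congr R R (by ext x <;> rfl) _ _ q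
  rw [hfac]
  infer_instance

/-- **The Künneth classes are isomorphisms `Ξₘ : Hₙ(F) ≅ H_{n+m}((Δᵐ, ∂Δᵐ) × F)`** (the single-cell
Künneth theorem, cross-product-free). [cite: Spanier1981, Ch. 9 Sec. 2 Thm. 15 (a) (proof)] -/
theorem isIso_Ξ : ∀ (m n : ℕ), IsIso (Ξ F R m n)
  | 0, n => by
    haveI := relativeSingularHomology.isIso_ofAbsolute_of_isEmpty R R (X := StdSimplex 0 × F) (bd F 0) n
    change IsIso (singularHomology.map R R (prodZeroHomeomorph F : C(F, StdSimplex 0 × F)) n ≫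
      relativeSingularHomology.ofAbsolute R R (StdSimplex 0 × F) (bd F 0) n)
    haveI : IsIso (singularHomology.map R R (prodZeroHomeomorph F : C(F, StdSimplex 0 × F)) n) :=
      (singularHomology.mapIso R R (prodZeroHomeomorph F) n).isIso_hom
    infer_instance
  | m + 1, n => by
    haveI := isIso_Ξ m n
    haveI := isIso_tripleδ_horn (F := F) R (m := m) 0 (n + m)
    haveI := isIso_map_E_horn (F := F) R (m := m) 0 (n + m)
    change IsIso (Ξ F R m n ≫ relativeSingularHomology.map R R (E F 0) (mapsTo_E_horn 0 0) (n + m) ≫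
      inv (relativeSingularHomology.tripleδ R R (StdSimplex (m + 1) × F) (bd F (m + 1)) (horn F 0) (n + m)))
    infer_instance

end FaceIso


/-! ### The face decomposition `H_q((∂Δᵐ⁺¹, (Δᵐ⁺¹)ᵐ⁻¹) × F) ≅ ⊕ⱼ H_q((Δᵐ, ∂Δᵐ) × F)` -/

section Decomposition

variable {m : ℕ}

/-- The bundle `Δᵐ⁺¹ × F → Δᵐ⁺¹`. [folklore] -/
theorem hp_fst : IsFibreBundleWith F (Prod.fst : StdSimplex (m + 1) × F → StdSimplex (m + 1)) := isFibreBundleWith_fst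

/-- `δⱼ z` lies in the closed cell of the coface `j`. [folklore] -/
theorem stdFace_mem_closedCell (j : Fin (m + 2)) (z : StdSimplex m) :
    stdFace j z ∈ closedCell (C := (univ : Set (StdSimplex (m + 1)))) m (coface j) := by
  rw [closedCell_eq]
  exact (mem_closedFace_coface_iff j).2 (stdFace_apply_self j z)

omit [TopologicalSpace F] in
/-- Points over the closed cell of the coface `j` project to the closed face. [folklore] -/
theorem mem_closedFace_of_mem_Cl [TopologicalSpace F] (j : Fin (m + 2))
    (z : CellsDirectSum.Cl (Prod.fst : StdSimplex (m + 1) × F → StdSimplex (m + 1)) (coface j)) :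
    z.1.1 ∈ closedFace (coface j) := by
  rw [← closedCell_eq]; exact z.2

/-- **The coface as a homeomorphism of pairs `(Δᵐ, ∂Δᵐ) × F ≅ (p⁻¹ ēⱼ, p⁻¹ ėⱼ)`** onto the pieces of the
direct-sum theorem for `p = pr₁ : Δᵐ⁺¹ × F → Δᵐ⁺¹`. [folklore] -/
def EHat (j : Fin (m + 2)) :
    StdSimplex m × F ≃ₜ CellsDirectSum.Cl (Prod.fst : StdSimplex (m + 1) × F → StdSimplex (m + 1)) (coface j) where
  toFun x := ⟨(stdFace j x.1, x.2), stdFace_mem_closedCell j x.1⟩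
  invFun z := (faceRestr (coface j) z.1.1, z.1.2)
  left_inv x := by
    refine Prod.ext ?_ rfl
    show faceRestr (coface j) (stdFace j x.1) = x.1
    rw [← faceMap_coface, faceRestr_faceMap]
  right_inv z := by
    apply Subtype.ext
    refine Prod.ext ?_ rfl
    show stdFace j (faceRestr (coface j) z.1.1) = z.1.1
    rw [← faceMap_coface, faceMap_faceRestr _ (mem_closedFace_of_mem_Cl j z)]
  continuous_toFun := (((stdFace j).continuous.comp continuous_fst).prodMk continuous_snd).subtype_mk _
  continuous_invFun := ((faceRestr (coface j)).continuous.comp (continuous_fst.comp continuous_subtype_val)).prodMk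
    (continuous_snd.comp continuous_subtype_val)

/-- `Ê j` maps `∂Δᵐ × F` onto the frontier piece. [folklore] -/
theorem mapsTo_EHat (j : Fin (m + 2)) :
    MapsTo (EHat (F := F) j) (bd F m) (CellsDirectSum.fr (Prod.fst : StdSimplex (m + 1) × F → _) (coface j)) := by
  intro x hx
  obtain ⟨l, hl⟩ := mem_bd_iff.1 hx
  show stdFace j x.1 ∈ cellFrontier (C := (univ : Set (StdSimplex (m + 1)))) m (coface j)
  rw [cellFrontier_eq]
  refine ⟨(mem_closedFace_coface_iff j).2 (stdFace_apply_self j x.1), l, ?_⟩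
  rw [coface_emb_apply, stdFace_apply_succAbove, hl]

/-- `Ê j⁻¹` maps the frontier piece to `∂Δᵐ × F`. [folklore] -/
theorem mapsTo_EHat_symm (j : Fin (m + 2)) :
    MapsTo (EHat (F := F) j).symm (CellsDirectSum.fr (Prod.fst : StdSimplex (m + 1) × F → _) (coface j)) (bd F m) := by
  intro z hz
  have hz' : z.1.1 ∈ cellFrontier (C := (univ : Set (StdSimplex (m + 1)))) m (coface j) := hz
  rw [cellFrontier_eq] at hz'
  obtain ⟨hcl, i, hi⟩ := hz'
  refine mem_bd_iff.2 ⟨i, ?_⟩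
  show (faceRestr (coface j) z.1.1 : Fin (m + 1) → ℝ) i = 0
  rw [faceRestr_apply_of_mem _ hcl, hi]

/-- `ιⱼ ∘ Ê j = Eʲ`. [folklore] -/
theorem ιCY_comp_EHat (j : Fin (m + 2)) :
    (CellsDirectSum.ιCY (Prod.fst : StdSimplex (m + 1) × F → _) (coface j)).comp
      ((EHat (F := F) j : StdSimplex m × F ≃ₜ _) : C(StdSimplex m × F, _)) = E F j := by
  ext x <;> rfl

/-- **The face decomposition**: `(yⱼ)ⱼ ↦ ∑ⱼ (Eʲ)_* yⱼ` is a bijection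
`⊕_{j : Fin (m+2)} H_q((Δᵐ, ∂Δᵐ) × F) ≅ H_q((∂Δᵐ⁺¹, (Δᵐ⁺¹)ᵐ⁻¹) × F)` — the direct-sum theorem
(`CellsDirectSum.directSum_map_ιCY_bijective`, Spanier 9.2 Lemma 2) for the trivial bundle over `Δᵐ⁺¹`,
reindexed by the cofaces. [cite: Spanier1981, Ch. 9 Sec. 2 Lemma 2] -/
theorem sum_map_E_bijective (q : ℕ) :
    Function.Bijective fun y : Fin (m + 2) → relativeSingularHomology R R (StdSimplex m × F) (bd F m) q =>
      ∑ j, (relativeSingularHomology.map R R (E F j) (mapsTo_E_sk j) q) (y j) := by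
  classical
  let Hc := fun c : cell (univ : Set (StdSimplex (m + 1))) m =>
    relativeSingularHomology R R (CellsDirectSum.Cl (Prod.fst : StdSimplex (m + 1) × F → StdSimplex (m + 1)) c) (CellsDirectSum.fr (Prod.fst : StdSimplex (m + 1) × F → StdSimplex (m + 1)) c) q
  have hΦ := CellsDirectSum.directSum_map_ιCY_bijective (s := m) R (hp_fst (F := F) (m := m)) q
  -- the pieces are `(Δᵐ, ∂Δᵐ) × F` through the cofaces
  let θ := fun j : Fin (m + 2) =>
    relativeSingularHomology.map R R ((EHat (F := F) j : StdSimplex m × F ≃ₜ _) :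
      C(StdSimplex m × F, CellsDirectSum.Cl (Prod.fst : StdSimplex (m + 1) × F → StdSimplex (m + 1)) (coface j))) (mapsTo_EHat (F := F) j) q
  haveI hθ : ∀ j, IsIso (θ j) := fun j =>
    relativeSingularHomology.isIso_map_homeomorph R R (EHat (F := F) j) (mapsTo_EHat j) (mapsTo_EHat_symm j) q
  have hθι : ∀ j, θ j ≫ relativeSingularHomology.map R R (CellsDirectSum.ιCY (Prod.fst : StdSimplex (m + 1) × F → StdSimplex (m + 1)) (coface j))
      (CellsDirectSum.mapsTo_ιCY_fr (p := (Prod.fst : StdSimplex (m + 1) × F → StdSimplex (m + 1))) (coface j)) q = relativeSingularHomology.map R R (E F j) (mapsTo_E_sk j) q := fun j => by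
    rw [← relativeSingularHomology.map_comp]
    exact relativeSingularHomology.map_congr R R (ιCY_comp_EHat (F := F) j) _ _ q
  let Ψ : (Fin (m + 2) → relativeSingularHomology R R (StdSimplex m × F) (bd F m) q) → DirectSum _ fun c => Hc c :=
    fun y => ∑ j, DirectSum.lof R _ (fun c => Hc c) (coface j) ((θ j) (y j))
  have hcomp : (fun y : Fin (m + 2) → relativeSingularHomology R R (StdSimplex m × F) (bd F m) q =>
      ∑ j, (relativeSingularHomology.map R R (E F j) (mapsTo_E_sk j) q) (y j)) =
      (DirectSum.toModule R (cell (univ : Set (StdSimplex (m + 1))) m)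
        (relativeSingularHomology R R ↥(CellsDirectSum.tot (Prod.fst : StdSimplex (m + 1) × F → StdSimplex (m + 1)) m)
          (CellsDirectSum.low (Prod.fst : StdSimplex (m + 1) × F → StdSimplex (m + 1)) m) q)
        fun c => (relativeSingularHomology.map R R (CellsDirectSum.ιCY (Prod.fst : StdSimplex (m + 1) × F → StdSimplex (m + 1)) c) (CellsDirectSum.mapsTo_ιCY_fr c) q).hom) ∘ Ψ := by
    funext y
    rw [Function.comp_apply]
    simp only [Ψ, map_sum]
    refine Finset.sum_congr rfl fun j _ => ?_
    rw [DirectSum.toModule_lof]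
    have := congrArg (fun φ => φ (y j)) (hθι j)
    simp only [ModuleCat.comp_apply] at this
    exact this.symm
  rw [hcomp]
  haveI : Fintype (cell (univ : Set (StdSimplex (m + 1))) m) := inferInstanceAs (Fintype (Face (m + 1) m))
  let e : Fin (m + 2) ≃ cell (univ : Set (StdSimplex (m + 1))) m := cofaceEquiv m
  have hsum : ∀ (z : Fin (m + 2) → relativeSingularHomology R R (StdSimplex m × F) (bd F m) q) (j : Fin (m + 2)),
      DirectSum.component R _ (fun c => Hc c) (coface j) (Ψ z) = θ j (z j) := fun z j => by
    simp only [Ψ, map_sum]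
    rw [Finset.sum_eq_single j]
    · exact DirectSum.component.lof_self (R := R) (ι := cell (univ : Set (StdSimplex (m + 1))) m) (coface j) _
    · intro i _ hij
      rw [DirectSum.component.of (R := R) (ι := cell (univ : Set (StdSimplex (m + 1))) m), dif_neg]
      exact fun h' => hij (e.injective h')
    · exact fun h' => absurd (Finset.mem_univ j) h'
  refine hΦ.comp ⟨fun y y' h => ?_, fun d => ?_⟩
  · funext j
    have hj := congrArg (DirectSum.component R _ (fun c => Hc c) (coface j)) h
    rw [hsum, hsum] at hj
    exact ((ModuleCat.mono_iff_injective (θ j)).1 inferInstance) hj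
  · refine ⟨fun j => inv (θ j) (d (coface j)), ?_⟩
    have h1 : ∀ j, (θ j) (inv (θ j) (d (coface j))) = d (coface j) := fun j => by
      rw [← ModuleCat.comp_apply, IsIso.inv_hom_id, ModuleCat.id_apply]
    simp only [Ψ, h1, DirectSum.lof_eq_of]
    rw [show (∑ j, DirectSum.of (fun c => Hc c) (coface j) (d (coface j))) =
        ∑ c, DirectSum.of (fun c => Hc c) c (d c) from
      Fintype.sum_equiv e _ (fun c => DirectSum.of (fun c => Hc c) c (d c)) fun j => rfl]
    exact DirectSum.sum_univ_of d

omit [TopologicalSpace F] in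
/-- The identity of `∂Δᵐ⁺¹ × F` as a map of pairs `(∂Δᵐ⁺¹, (Δᵐ⁺¹)ᵐ⁻¹) × F → (∂Δᵐ⁺¹, Λₖ) × F`. [folklore] -/
theorem mapsTo_id_sk_horn [TopologicalSpace F] (k : Fin (m + 2)) :
    MapsTo (ContinuousMap.id ↥(bd F (m + 1))) (Subtype.val ⁻¹' sk F m) (Subtype.val ⁻¹' horn F k) :=
  fun _ hx => sk_subset_horn k hx

/-- `(Eʲ)_*` followed by the projection to `(∂Δᵐ⁺¹, Λₖ) × F` vanishes for `j ≠ k` (the face lies in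
the horn). [folklore] -/
theorem map_E_comp_proj_eq_zero {j k : Fin (m + 2)} (hjk : j ≠ k) (q : ℕ) :
    relativeSingularHomology.map R R (E F j) (mapsTo_E_sk j) q ≫
      relativeSingularHomology.map R R (ContinuousMap.id _) (mapsTo_id_sk_horn (F := F) k) q = 0 := by
  -- the composite factors through `H_q(Δᵐ × F, Δᵐ × F) = 0`
  have hE : MapsTo (E F j) (univ : Set (StdSimplex m × F)) (Subtype.val ⁻¹' horn F k) := fun x _ =>
    ⟨j, hjk, stdFace_apply_self j x.1⟩
  have hfac : relativeSingularHomology.map R R (E F j) (mapsTo_E_sk j) q ≫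
      relativeSingularHomology.map R R (ContinuousMap.id _) (mapsTo_id_sk_horn (F := F) k) q =
      relativeSingularHomology.map R R (ContinuousMap.id _) (mapsTo_univ id (bd F m) : MapsTo id (bd F m) univ) q ≫
        relativeSingularHomology.map R R (E F j) hE q := by
    rw [← relativeSingularHomology.map_comp, ← relativeSingularHomology.map_comp]
    rfl
  rw [hfac, (isZero_relativeSingularHomology_univ R R (X := StdSimplex m × F) q).eq_of_src
    (relativeSingularHomology.map R R (E F j) hE q) 0, comp_zero]

end Decomposition


/-! ### Adjacent transpositions of the vertices -/

section Transpositions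

/-- `(k k+1) ∘ δ_k = δ_{k+1}` on vertex indices. [folklore] -/
theorem swap_succAbove_castSucc {m : ℕ} (k l : Fin (m + 1)) :
    Equiv.swap k.castSucc k.succ (k.castSucc.succAbove l) = k.succ.succAbove l := by
  rcases lt_trichotomy l k with h | rfl | h
  · have h1 : l.castSucc < k.castSucc := Fin.castSucc_lt_castSucc_iff.2 h
    have h2 : l.castSucc < k.succ := by rw [Fin.lt_def] at h1 ⊢; simp [Fin.val_succ] at h1 ⊢; omega
    rw [Fin.succAbove_of_castSucc_lt _ _ h1, Fin.succAbove_of_castSucc_lt _ _ h2,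
      Equiv.swap_apply_of_ne_of_ne h1.ne h2.ne]
  · rw [Fin.succAbove_castSucc_self, Fin.succAbove_succ_self, Equiv.swap_apply_right]
  · have h1 : k.castSucc ≤ l.castSucc := Fin.castSucc_le_castSucc_iff.2 h.le
    have h2 : k.succ ≤ l.castSucc := by rw [Fin.le_def]; rw [Fin.lt_def] at h; simp [Fin.val_succ]; omega
    rw [Fin.succAbove_of_le_castSucc _ _ h1, Fin.succAbove_of_le_castSucc _ _ h2, Equiv.swap_apply_of_ne_of_ne]
    · intro h'; rw [Fin.ext_iff] at h'; rw [Fin.lt_def] at h; simp [Fin.val_succ] at h'; omega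
    · intro h'; rw [Fin.ext_iff] at h'; rw [Fin.lt_def] at h; simp [Fin.val_succ] at h'; omega

/-- `(k k+1) ∘ δ_{k+1} = δ_k` on vertex indices. [folklore] -/
theorem swap_succAbove_succ {m : ℕ} (k l : Fin (m + 1)) :
    Equiv.swap k.castSucc k.succ (k.succ.succAbove l) = k.castSucc.succAbove l := by
  rw [← swap_succAbove_castSucc, Equiv.swap_apply_self]

/-- `(k+1 k+2) ∘ δ₀ = δ₀ ∘ (k k+1)`: the transposition seen from the `0`-th face. [folklore] -/
theorem swap_succ_succAbove_zero {m : ℕ} (k : Fin (m + 1)) (l : Fin (m + 2)) :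
    Equiv.swap k.succ.castSucc k.succ.succ ((0 : Fin (m + 3)).succAbove l) =
      (0 : Fin (m + 3)).succAbove (Equiv.swap k.castSucc k.succ l) := by
  simp only [Fin.succAbove_zero]
  rw [show k.succ.castSucc = k.castSucc.succ from rfl]
  exact (Fin.succ_injective _).map_swap k.castSucc k.succ l ▸ rfl

/-- `(0 1) ∘ δ_last = δ_last ∘ (0 1)`: the first transposition seen from the last face. [folklore] -/
theorem swap_zero_succAbove_last {m : ℕ} (l : Fin (m + 2)) :
    Equiv.swap (0 : Fin (m + 3)) 1 ((Fin.last (m + 2)).succAbove l) =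
      (Fin.last (m + 2)).succAbove (Equiv.swap (0 : Fin (m + 2)) 1 l) := by
  simp only [Fin.succAbove_last]
  have := (Fin.castSucc_injective (m + 2)).map_swap (0 : Fin (m + 2)) 1 l
  rw [this]
  rfl

/-- The vertex permutation `g` acting on `Δˢ` (Mathlib's `stdSimplex.map`). [folklore] -/
def permMap {s : ℕ} (g : Equiv.Perm (Fin (s + 1))) : C(StdSimplex s, StdSimplex s) :=
  ⟨stdSimplex.map g, stdSimplex.continuous_map _⟩

/-- Coordinates of a permuted point: `(g z)_{g i} = z_i`. [folklore] -/
theorem permMap_apply_coord {s : ℕ} (g : Equiv.Perm (Fin (s + 1))) (z : StdSimplex s) (i : Fin (s + 1)) :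
    (permMap g z : Fin (s + 1) → ℝ) (g i) = z i :=
  stdSimplex_map_apply_of_injective g.injective z i

/-- Coordinates of a permuted point: `(g z)_i = z_{g⁻¹ i}`. [folklore] -/
theorem permMap_apply_coord' {s : ℕ} (g : Equiv.Perm (Fin (s + 1))) (z : StdSimplex s) (i : Fin (s + 1)) :
    (permMap g z : Fin (s + 1) → ℝ) i = z (g.symm i) := by
  conv_lhs => rw [← g.apply_symm_apply i]
  exact permMap_apply_coord g z _

/-- `g ∘ δⱼ` through `stdSimplex.map`. [folklore] -/
theorem permMap_stdFace {m : ℕ} (g : Equiv.Perm (Fin (m + 2))) (j : Fin (m + 2)) (z : StdSimplex m) :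
    permMap g (stdFace j z) = stdSimplex.map (g ∘ j.succAbove) z := by
  show stdSimplex.map g (stdSimplex.map j.succAbove z) = _
  rw [stdSimplex.map_comp_apply]

/-- **`(k k+1) ∘ δ_k = δ_{k+1}`** as maps of standard simplices. [folklore] -/
theorem permMap_swap_stdFace_castSucc {m : ℕ} (k : Fin (m + 1)) (z : StdSimplex m) :
    permMap (Equiv.swap k.castSucc k.succ) (stdFace k.castSucc z) = stdFace k.succ z := by
  rw [permMap_stdFace, stdFace_apply]
  congr 1
  funext l
  exact swap_succAbove_castSucc k l

/-- **`(k k+1) ∘ δ_{k+1} = δ_k`** as maps of standard simplices. [folklore] -/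
theorem permMap_swap_stdFace_succ {m : ℕ} (k : Fin (m + 1)) (z : StdSimplex m) :
    permMap (Equiv.swap k.castSucc k.succ) (stdFace k.succ z) = stdFace k.castSucc z := by
  rw [permMap_stdFace, stdFace_apply]
  congr 1
  funext l
  exact swap_succAbove_succ k l

/-- **`(k+1 k+2) ∘ δ₀ = δ₀ ∘ (k k+1)`** as maps of standard simplices. [folklore] -/
theorem permMap_swap_succ_stdFace_zero {m : ℕ} (k : Fin (m + 1)) (z : StdSimplex (m + 1)) :
    permMap (Equiv.swap k.succ.castSucc k.succ.succ) (stdFace 0 z) =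
      stdFace 0 (permMap (Equiv.swap k.castSucc k.succ) z) := by
  rw [permMap_stdFace, stdFace_apply]
  show _ = stdSimplex.map _ (stdSimplex.map _ z)
  rw [stdSimplex.map_comp_apply]
  congr 1
  funext l
  exact swap_succ_succAbove_zero k l

/-- **`(0 1) ∘ δ_last = δ_last ∘ (0 1)`** as maps of standard simplices. [folklore] -/
theorem permMap_swap_zero_stdFace_last {m : ℕ} (z : StdSimplex (m + 1)) :
    permMap (Equiv.swap (0 : Fin (m + 3)) 1) (stdFace (Fin.last (m + 2)) z) =
      stdFace (Fin.last (m + 2)) (permMap (Equiv.swap (0 : Fin (m + 2)) 1) z) := by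
  rw [permMap_stdFace, stdFace_apply]
  show _ = stdSimplex.map _ (stdSimplex.map _ z)
  rw [stdSimplex.map_comp_apply]
  congr 1
  funext l
  exact swap_zero_succAbove_last l

end Transpositions


/-! ### The boundary formula: toolkit at level `m` (the `(m+1)`-simplex and its `m+2` faces) -/

section BoundaryFormula

variable (n : ℕ)

/-- `A_m = H_{n+m}((Δᵐ, ∂Δᵐ) × F)`. [folklore] -/
abbrev Amod (m : ℕ) : ModuleCat.{max w uR} R := relativeSingularHomology R R (StdSimplex m × F) (bd F m) (n + m)

/-- `G_m = H_{n+m}((∂Δᵐ⁺¹, (Δᵐ⁺¹)ᵐ⁻¹) × F)`. [folklore] -/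
abbrev Gmod (m : ℕ) : ModuleCat.{max w uR} R :=
  relativeSingularHomology R R ↥(bd F (m + 1)) (Subtype.val ⁻¹' sk F m) (n + m)

/-- `H_{n+m}((∂Δᵐ⁺¹, Λₖ) × F)`. [folklore] -/
abbrev Hk (m : ℕ) (k : Fin (m + 2)) : ModuleCat.{max w uR} R :=
  relativeSingularHomology R R ↥(bd F (m + 1)) (Subtype.val ⁻¹' horn F k) (n + m)

/-- `(Eʲ)_* : A_m → G_m`. [folklore] -/
abbrev eMap (m : ℕ) (j : Fin (m + 2)) : Amod (F := F) R n m ⟶ Gmod (F := F) R n m :=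
  relativeSingularHomology.map R R (E F j) (mapsTo_E_sk j) (n + m)

/-- `(Eᵏ)_* : A_m → H((∂Δᵐ⁺¹, Λₖ) × F)` (an isomorphism, `isIso_map_E_horn`). [folklore] -/
abbrev eHorn (m : ℕ) (k : Fin (m + 2)) : Amod (F := F) R n m ⟶ Hk (F := F) R n m k :=
  relativeSingularHomology.map R R (E F k) (mapsTo_E_horn k k) (n + m)

/-- The projection `G_m → H((∂Δᵐ⁺¹, Λₖ) × F)`. [folklore] -/
abbrev proj (m : ℕ) (k : Fin (m + 2)) : Gmod (F := F) R n m ⟶ Hk (F := F) R n m k :=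
  relativeSingularHomology.map R R (ContinuousMap.id _) (mapsTo_id_sk_horn (F := F) k) (n + m)

/-- `∂ : H_{n+m+1}((Δᵐ⁺¹, ∂Δᵐ⁺¹) × F) → G_m`, the boundary of the triple with the codimension-2
skeleton. [folklore] -/
abbrev δsk (m : ℕ) : relativeSingularHomology R R (StdSimplex (m + 1) × F) (bd F (m + 1)) (n + m + 1) ⟶
    Gmod (F := F) R n m :=
  relativeSingularHomology.tripleδ R R (StdSimplex (m + 1) × F) (bd F (m + 1)) (sk F m) (n + m)

/-- `∂ : H_{n+m+1}((Δᵐ⁺¹, ∂Δᵐ⁺¹) × F) → H((∂Δᵐ⁺¹, Λₖ) × F)`, the boundary of the triple with a horn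
(an isomorphism, `isIso_tripleδ_horn`). [folklore] -/
abbrev δhorn (m : ℕ) (k : Fin (m + 2)) :
    relativeSingularHomology R R (StdSimplex (m + 1) × F) (bd F (m + 1)) (n + m + 1) ⟶ Hk (F := F) R n m k :=
  relativeSingularHomology.tripleδ R R (StdSimplex (m + 1) × F) (bd F (m + 1)) (horn F k) (n + m)

variable {n}

/-- A map of pairs `(Δᵐ, ∂Δᵐ) × F → (∂Δᵐ⁺¹, skel) × F` landing in the horn `Λₖ × F` dies under the
projection to `(∂Δᵐ⁺¹, Λₖ) × F`. [folklore] -/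
theorem map_comp_proj_eq_zero {m : ℕ} {k : Fin (m + 2)} (g : C(StdSimplex m × F, ↥(bd F (m + 1))))
    (hg : MapsTo g (bd F m) (Subtype.val ⁻¹' sk F m)) (hall : ∀ x, (g x : StdSimplex (m + 1) × F) ∈ horn F k) :
    relativeSingularHomology.map R R g hg (n + m) ≫ proj (F := F) R n m k = 0 := by
  have hE : MapsTo g (univ : Set (StdSimplex m × F)) (Subtype.val ⁻¹' horn F k) := fun x _ => hall x
  have hfac : relativeSingularHomology.map R R g hg (n + m) ≫ proj (F := F) R n m k =
      relativeSingularHomology.map R R (ContinuousMap.id _) (mapsTo_univ id (bd F m) : MapsTo id (bd F m) univ) (n + m) ≫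
        relativeSingularHomology.map R R g hE (n + m) := by
    rw [← relativeSingularHomology.map_comp, ← relativeSingularHomology.map_comp]
    rfl
  rw [hfac, (isZero_relativeSingularHomology_univ R R (X := StdSimplex m × F) (n + m)).eq_of_src
    (relativeSingularHomology.map R R g hE (n + m)) 0, comp_zero]

/-- `(Eʲ)_* ≫ projₖ = 0` for `j ≠ k`. [folklore] -/
@[reassoc]
theorem eMap_comp_proj_of_ne {m : ℕ} {j k : Fin (m + 2)} (hjk : j ≠ k) :
    eMap (F := F) R n m j ≫ proj (F := F) R n m k = 0 :=
  map_comp_proj_eq_zero R (E F j) (mapsTo_E_sk j) fun x => ⟨j, hjk, stdFace_apply_self j x.1⟩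

/-- `(Eᵏ)_* ≫ projₖ = (Eᵏ)_*` into the horn pair. [folklore] -/
@[reassoc]
theorem eMap_comp_proj_self {m : ℕ} (k : Fin (m + 2)) :
    eMap (F := F) R n m k ≫ proj (F := F) R n m k = eHorn (F := F) R n m k := by
  rw [← relativeSingularHomology.map_comp]
  rfl

/-- `∂_sk ≫ projₖ = ∂_{Λₖ}`. [folklore] -/
@[reassoc]
theorem δsk_comp_proj {m : ℕ} (k : Fin (m + 2)) : δsk (F := F) R n m ≫ proj (F := F) R n m k = δhorn (F := F) R n m k :=
  relativeSingularHomology.tripleδ_comp_map_id R R (bd F (m + 1)) (sk_subset_horn (F := F) k) (n + m)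

/-- `Ξₘ₊₁ ≫ ∂_{Λ₀} = Ξₘ ≫ (E⁰)_*` (the definition of `Ξₘ₊₁`). [folklore] -/
theorem Ξ_succ_comp_δhorn_zero (m : ℕ) :
    Ξ F R (m + 1) n ≫ δhorn (F := F) R n m 0 = Ξ F R m n ≫ eHorn (F := F) R n m 0 := by
  haveI := isIso_tripleδ_horn (F := F) R (m := m) 0 (n + m)
  show (Ξ F R m n ≫ relativeSingularHomology.map R R (E F 0) (mapsTo_E_horn 0 0) (n + m) ≫
    inv (relativeSingularHomology.tripleδ R R (StdSimplex (m + 1) × F) (bd F (m + 1)) (horn F 0) (n + m))) ≫ _ = _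
  simp only [Category.assoc, IsIso.inv_hom_id, Category.comp_id]

/-- `∂_sk` is injective (it refines the isomorphism `∂_{Λ₀}`). [folklore] -/
instance mono_δsk (m : ℕ) : Mono (δsk (F := F) R n m) := by
  haveI := isIso_tripleδ_horn (F := F) R (m := m) 0 (n + m)
  haveI : Mono (δsk (F := F) R n m ≫ proj (F := F) R n m 0) := by rw [δsk_comp_proj]; infer_instance
  exact mono_of_mono (δsk (F := F) R n m) (proj (F := F) R n m 0)

/-- The face components: the linear map `(yⱼ) ↦ ∑ⱼ (Eʲ)_* yⱼ`. [folklore] -/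
def Λ (m : ℕ) : (Fin (m + 2) → Amod (F := F) R n m) →ₗ[R] Gmod (F := F) R n m where
  toFun y := ∑ j, eMap (F := F) R n m j (y j)
  map_add' y y' := by simp only [Pi.add_apply, map_add, Finset.sum_add_distrib]
  map_smul' r y := by simp only [Pi.smul_apply, map_smul, Finset.smul_sum, RingHom.id_apply]

/-- `Λ` is a linear isomorphism (`sum_map_E_bijective`). [folklore] -/
def Λe (m : ℕ) : (Fin (m + 2) → Amod (F := F) R n m) ≃ₗ[R] Gmod (F := F) R n m :=
  LinearEquiv.ofBijective (Λ (F := F) R (n := n) m) (sum_map_E_bijective (F := F) R (m := m) (n + m))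

/-- The face components `cf x` of `x ∈ G_m`: `x = ∑ⱼ (Eʲ)_* (cf x j)`. [folklore] -/
def cf {m : ℕ} (x : Gmod (F := F) R n m) : Fin (m + 2) → Amod (F := F) R n m := (Λe (F := F) R (n := n) m).symm x

/-- `x = ∑ⱼ (Eʲ)_* (cf x j)`. [folklore] -/
theorem sum_eMap_cf {m : ℕ} (x : Gmod (F := F) R n m) : ∑ j, eMap (F := F) R n m j (cf R x j) = x :=
  (Λe (F := F) R (n := n) m).apply_symm_apply x

/-- Uniqueness of the face components. [folklore] -/
theorem cf_eq_of_sum_eq {m : ℕ} {x : Gmod (F := F) R n m} {y : Fin (m + 2) → Amod (F := F) R n m}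
    (h : ∑ j, eMap (F := F) R n m j (y j) = x) : cf R x = y := by
  unfold cf
  rw [LinearEquiv.symm_apply_eq]
  exact h.symm

/-- The face components are additive. [folklore] -/
theorem cf_add {m : ℕ} (x x' : Gmod (F := F) R n m) : cf R (x + x') = cf R x + cf R x' := map_add _ x x'

/-- The face components commute with negation. [folklore] -/
theorem cf_neg {m : ℕ} (x : Gmod (F := F) R n m) : cf R (-x) = -cf R x := map_neg _ x

/-- **The `k`-th projection sees only the `k`-th component**: `projₖ x = (Eᵏ)_* (cf x k)`. [folklore] -/
theorem proj_eq_eHorn_cf {m : ℕ} (x : Gmod (F := F) R n m) (k : Fin (m + 2)) :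
    proj (F := F) R n m k x = eHorn (F := F) R n m k (cf R x k) := by
  conv_lhs => rw [← sum_eMap_cf R x]
  rw [map_sum, Finset.sum_eq_single k]
  · rw [← ModuleCat.comp_apply, eMap_comp_proj_self]
  · intro j _ hjk
    rw [← ModuleCat.comp_apply, eMap_comp_proj_of_ne R hjk]
    simp
  · exact fun h => absurd (Finset.mem_univ k) h

/-! ### The transpositions acting on the pairs -/

/-- `(k k+1) × 𝟙` on `Δᵐ⁺¹ × F`. [folklore] -/
abbrev τX (m : ℕ) (k : Fin (m + 1)) : C(StdSimplex (m + 1) × F, StdSimplex (m + 1) × F) :=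
  ContinuousMap.prodMap (permMap (Equiv.swap k.castSucc k.succ)) (ContinuousMap.id F)

omit [TopologicalSpace F] in
/-- Vertex permutations preserve `∂Δᵐ⁺¹ × F`. [folklore] -/
theorem mapsTo_permMap_prod_bd [TopologicalSpace F] {m : ℕ} (g : Equiv.Perm (Fin (m + 2))) :
    MapsTo (ContinuousMap.prodMap (permMap g) (ContinuousMap.id F)) (bd F (m + 1)) (bd F (m + 1)) := fun x hx => by
  obtain ⟨i, hi⟩ := mem_bd_iff.1 hx
  exact mem_bd_iff.2 ⟨g i, by show (permMap g x.1 : Fin (m + 2) → ℝ) (g i) = 0; rw [permMap_apply_coord, hi]⟩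

/-- `(k k+1) × 𝟙` preserves the boundary. [folklore] -/
theorem mapsTo_τX_bd {m : ℕ} (k : Fin (m + 1)) : MapsTo (τX (F := F) m k) (bd F (m + 1)) (bd F (m + 1)) :=
  mapsTo_permMap_prod_bd _

/-- `(k k+1) × 𝟙` on `∂Δᵐ⁺¹ × F`. [folklore] -/
abbrev τB (m : ℕ) (k : Fin (m + 1)) : C(↥(bd F (m + 1)), ↥(bd F (m + 1))) :=
  subsetRestrict (τX (F := F) m k) (mapsTo_τX_bd k)

omit [TopologicalSpace F] in
/-- The support of a permuted point is the permuted support. [folklore] -/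
theorem support_permMap {s : ℕ} (g : Equiv.Perm (Fin (s + 1))) (z : StdSimplex s) :
    StdSimplexCW.support (permMap g z) = (StdSimplexCW.support z).map g.toEmbedding := by
  ext i
  simp only [StdSimplexCW.mem_support_iff, Finset.mem_map_equiv, permMap_apply_coord']

/-- `(k k+1) × 𝟙` preserves the codimension-2 skeleton. [folklore] -/
theorem mapsTo_τB_sk {m : ℕ} (k : Fin (m + 1)) :
    MapsTo (τB (F := F) m k) (Subtype.val ⁻¹' sk F m) (Subtype.val ⁻¹' sk F m) := fun x hx => by
  have hx' : (StdSimplexCW.support x.1.1).card ≤ m := mem_sk_iff.1 hx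
  show ((permMap _ x.1.1, x.1.2) : StdSimplex (m + 1) × F) ∈ sk F m
  rw [mem_sk_iff]
  show (StdSimplexCW.support (permMap _ x.1.1)).card ≤ m
  rwa [support_permMap, Finset.card_map]

/-- The action `T` of `(k k+1)` on `H_q((Δᵐ⁺¹, ∂Δᵐ⁺¹) × F)`. [folklore] -/
abbrev T (m : ℕ) (k : Fin (m + 1)) (q : ℕ) :
    relativeSingularHomology R R (StdSimplex (m + 1) × F) (bd F (m + 1)) q ⟶
      relativeSingularHomology R R (StdSimplex (m + 1) × F) (bd F (m + 1)) q :=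
  relativeSingularHomology.map R R (τX (F := F) m k) (mapsTo_τX_bd k) q

/-- The action `TG` of `(k k+1)` on `G_m`. [folklore] -/
abbrev TG (m : ℕ) (k : Fin (m + 1)) : Gmod (F := F) R n m ⟶ Gmod (F := F) R n m :=
  relativeSingularHomology.map R R (τB (F := F) m k) (mapsTo_τB_sk k) (n + m)

/-- `T ≫ ∂_sk = ∂_sk ≫ TG` (naturality of the boundary). [folklore] -/
@[reassoc]
theorem T_comp_δsk {m : ℕ} (k : Fin (m + 1)) :
    T (F := F) R m k (n + (m + 1)) ≫ δsk (F := F) R n m = δsk (F := F) R n m ≫ TG (F := F) R (n := n) m k :=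
  tripleδ_naturality R (τX (F := F) m k) (mapsTo_τX_bd k) (mapsTo_τB_sk k) (n + m)

/-- `(k k+1) ∘ Eᵏ = Eᵏ⁺¹`. [folklore] -/
theorem τB_comp_E_castSucc {m : ℕ} (k : Fin (m + 1)) : (τB (F := F) m k).comp (E F k.castSucc) = E F k.succ := by
  ext x
  · show ((permMap (Equiv.swap k.castSucc k.succ) (stdFace k.castSucc x.1) : StdSimplex (m + 1)) : Fin (m + 2) → ℝ) _ = _
    rw [permMap_swap_stdFace_castSucc]
    rfl
  · rfl

/-- `(k k+1) ∘ Eᵏ⁺¹ = Eᵏ`. [folklore] -/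
theorem τB_comp_E_succ {m : ℕ} (k : Fin (m + 1)) : (τB (F := F) m k).comp (E F k.succ) = E F k.castSucc := by
  ext x
  · show ((permMap (Equiv.swap k.castSucc k.succ) (stdFace k.succ x.1) : StdSimplex (m + 1)) : Fin (m + 2) → ℝ) _ = _
    rw [permMap_swap_stdFace_succ]
    rfl
  · rfl

/-- `(Eᵏ)_* ≫ TG = (Eᵏ⁺¹)_*`. [folklore] -/
@[reassoc]
theorem eMap_castSucc_comp_TG {m : ℕ} (k : Fin (m + 1)) :
    eMap (F := F) R n m k.castSucc ≫ TG (F := F) R (n := n) m k = eMap (F := F) R n m k.succ := by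
  rw [← relativeSingularHomology.map_comp]
  exact relativeSingularHomology.map_congr R R (τB_comp_E_castSucc (F := F) k) _ _ _

/-- `(Eᵏ⁺¹)_* ≫ TG = (Eᵏ)_*`. [folklore] -/
@[reassoc]
theorem eMap_succ_comp_TG {m : ℕ} (k : Fin (m + 1)) :
    eMap (F := F) R n m k.succ ≫ TG (F := F) R (n := n) m k = eMap (F := F) R n m k.castSucc := by
  rw [← relativeSingularHomology.map_comp]
  exact relativeSingularHomology.map_congr R R (τB_comp_E_succ (F := F) k) _ _ _

/-- The transposed `j`-th face dies under the projection to `Λ_{k₀}` when `(k k+1) j ≠ k₀`. [folklore] -/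
theorem eMap_comp_TG_comp_proj {m : ℕ} (k : Fin (m + 1)) {j k₀ : Fin (m + 2)} (h : Equiv.swap k.castSucc k.succ j ≠ k₀) :
    eMap (F := F) R n m j ≫ TG (F := F) R (n := n) m k ≫ proj (F := F) R n m k₀ = 0 := by
  rw [← Category.assoc, ← relativeSingularHomology.map_comp]
  refine map_comp_proj_eq_zero R _ _ fun x => ⟨Equiv.swap k.castSucc k.succ j, h, ?_⟩
  show ((permMap (Equiv.swap k.castSucc k.succ) (stdFace j x.1) : StdSimplex (m + 1)) : Fin (m + 2) → ℝ)
    (Equiv.swap k.castSucc k.succ j) = 0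
  rw [permMap_apply_coord, stdFace_apply_self]

/-- Seen from the `0`-th face, `(k+1 k+2)` is `(k k+1)`. [folklore] -/
theorem τB_succ_comp_E_zero {m : ℕ} (k : Fin (m + 1)) :
    (τB (F := F) (m + 1) k.succ).comp (E F 0) = (E F 0).comp (τX (F := F) m k) := by
  ext x
  · show ((permMap (Equiv.swap k.succ.castSucc k.succ.succ) (stdFace 0 x.1) : StdSimplex (m + 2)) : Fin (m + 3) → ℝ) _ = _
    rw [permMap_swap_succ_stdFace_zero]
    rfl
  · rfl

/-- `(E⁰)_* ≫ TG_{(k+1 k+2)} = T_{(k k+1)} ≫ (E⁰)_*`. [folklore] -/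
@[reassoc]
theorem eMap_zero_comp_TG_succ {m : ℕ} (k : Fin (m + 1)) :
    eMap (F := F) R n (m + 1) 0 ≫ TG (F := F) R (n := n) (m + 1) k.succ = T (F := F) R m k (n + (m + 1)) ≫ eMap (F := F) R n (m + 1) 0 := by
  rw [← relativeSingularHomology.map_comp, ← relativeSingularHomology.map_comp]
  exact relativeSingularHomology.map_congr R R (τB_succ_comp_E_zero (F := F) k) _ _ _

/-- Seen from the last face, `(0 1)` is `(0 1)`. [folklore] -/
theorem τB_zero_comp_E_last (m : ℕ) :
    (τB (F := F) (m + 1) 0).comp (E F (Fin.last (m + 2))) = (E F (Fin.last (m + 2))).comp (τX (F := F) m 0) := by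
  ext x
  · show ((permMap (Equiv.swap (0 : Fin (m + 2)).castSucc (0 : Fin (m + 2)).succ) (stdFace (Fin.last (m + 2)) x.1) :
      StdSimplex (m + 2)) : Fin (m + 3) → ℝ) _ =
      ((stdFace (Fin.last (m + 2)) (permMap (Equiv.swap (0 : Fin (m + 1)).castSucc (0 : Fin (m + 1)).succ) x.1) :
        StdSimplex (m + 2)) : Fin (m + 3) → ℝ) _
    have h1 : Equiv.swap (0 : Fin (m + 2)).castSucc (0 : Fin (m + 2)).succ = Equiv.swap (0 : Fin (m + 3)) 1 := by
      rw [Fin.castSucc_zero, Fin.succ_zero_eq_one]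
    have h2 : Equiv.swap (0 : Fin (m + 1)).castSucc (0 : Fin (m + 1)).succ = Equiv.swap (0 : Fin (m + 2)) 1 := by
      rw [Fin.castSucc_zero, Fin.succ_zero_eq_one]
    rw [h1, h2, permMap_swap_zero_stdFace_last]
  · rfl

/-- `(E^last)_* ≫ TG_{(0 1)} = T_{(0 1)} ≫ (E^last)_*`. [folklore] -/
@[reassoc]
theorem eMap_last_comp_TG_zero (m : ℕ) :
    eMap (F := F) R n (m + 1) (Fin.last (m + 2)) ≫ TG (F := F) R (n := n) (m + 1) 0 =
      T (F := F) R m 0 (n + (m + 1)) ≫ eMap (F := F) R n (m + 1) (Fin.last (m + 2)) := by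
  rw [← relativeSingularHomology.map_comp, ← relativeSingularHomology.map_comp]
  exact relativeSingularHomology.map_congr R R (τB_zero_comp_E_last (F := F) m) _ _ _


/-! ### The boundary formula: the induction -/

section Induction

variable (n : ℕ)

/-- `D_m = ∂_sk ∘ Ξₘ₊₁ : Hₙ(F) → G_m`. [folklore] -/
abbrev D (m : ℕ) : singularHomology R R F n ⟶ Gmod (F := F) R n m := Ξ F R (m + 1) n ≫ δsk (F := F) R n m

variable {n}

/-- `projₖ (D w) = ∂_{Λₖ} (Ξₘ₊₁ w)`. [folklore] -/
theorem proj_D (m : ℕ) (k : Fin (m + 2)) (w : singularHomology R R F n) :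
    proj (F := F) R n m k (D (F := F) R n m w) = δhorn (F := F) R n m k (Ξ F R (m + 1) n w) := by
  rw [← ModuleCat.comp_apply, ← ModuleCat.comp_apply, Category.assoc, δsk_comp_proj]

/-- Classes of `Hₙ(F)` are detected by any one horn projection of `D`. [folklore] -/
theorem eq_of_proj_D_eq {m : ℕ} (k : Fin (m + 2)) {w₁ w₂ : singularHomology R R F n}
    (h : proj (F := F) R n m k (D (F := F) R n m w₁) = proj (F := F) R n m k (D (F := F) R n m w₂)) : w₁ = w₂ := by
  rw [proj_D, proj_D, ← ModuleCat.comp_apply, ← ModuleCat.comp_apply] at h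
  haveI := isIso_Ξ (F := F) R (m + 1) n
  haveI := isIso_tripleδ_horn (F := F) R (m := m) k (n + m)
  haveI : Mono (Ξ F R (m + 1) n ≫ δhorn (F := F) R n m k) := mono_comp _ _
  exact (ModuleCat.mono_iff_injective (Ξ F R (m + 1) n ≫ δhorn (F := F) R n m k)).1 inferInstance h

/-- **The `0`-th face component of `D w` is `Ξₘ w`** (the definition of `Ξₘ₊₁`). [folklore] -/
theorem cf_D_zero (m : ℕ) (w : singularHomology R R F n) : cf R (D (F := F) R n m w) 0 = Ξ F R m n w := by
  haveI := isIso_map_E_horn (F := F) R (m := m) 0 (n + m)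
  apply (ModuleCat.mono_iff_injective (eHorn (F := F) R n m 0)).1 inferInstance
  rw [← proj_eq_eHorn_cf, proj_D, ← ModuleCat.comp_apply, ← ModuleCat.comp_apply, Ξ_succ_comp_δhorn_zero]

/-- `cf (D (-w)) = - cf (D w)`. [folklore] -/
theorem cf_D_neg (m : ℕ) (w : singularHomology R R F n) : cf R (D (F := F) R n m (-w)) = -cf R (D (F := F) R n m w) := by
  rw [map_neg, cf_neg]

/-- The transposed class: `w'` with `Ξ w' = T (Ξ w)`. [folklore] -/
def twist (m : ℕ) (k : Fin (m + 1)) (w : singularHomology R R F n) : singularHomology R R F n :=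
  haveI := isIso_Ξ (F := F) R (m + 1) n
  inv (Ξ F R (m + 1) n) (T (F := F) R m k (n + (m + 1)) (Ξ F R (m + 1) n w))

/-- `Ξ w' = T (Ξ w)`. [folklore] -/
theorem Ξ_twist (m : ℕ) (k : Fin (m + 1)) (w : singularHomology R R F n) :
    Ξ F R (m + 1) n (twist (F := F) R m k w) = T (F := F) R m k (n + (m + 1)) (Ξ F R (m + 1) n w) := by
  haveI := isIso_Ξ (F := F) R (m + 1) n
  unfold twist
  rw [← ModuleCat.comp_apply, IsIso.inv_hom_id, ModuleCat.id_apply]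

/-- `D w' = TG (D w)`. [folklore] -/
theorem D_twist (m : ℕ) (k : Fin (m + 1)) (w : singularHomology R R F n) :
    D (F := F) R n m (twist (F := F) R m k w) = TG (F := F) R (n := n) m k (D (F := F) R n m w) := by
  show δsk (F := F) R n m (Ξ F R (m + 1) n (twist (F := F) R m k w)) =
    TG (F := F) R (n := n) m k (δsk (F := F) R n m (Ξ F R (m + 1) n w))
  rw [Ξ_twist, ← ModuleCat.comp_apply, T_comp_δsk R k, ModuleCat.comp_apply]

/-- `proj_{k₀} (TG (D w))` computed from the single face `j` with `(k k+1) j = k₀`… here in the form: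
all faces `j` with `(k k+1) j ≠ k₀` are invisible. [folklore] -/
theorem proj_TG_D (m : ℕ) (k : Fin (m + 1)) (k₀ j₁ : Fin (m + 2)) (hj₁ : Equiv.swap k.castSucc k.succ j₁ = k₀)
    (w : singularHomology R R F n) :
    proj (F := F) R n m k₀ (TG (F := F) R (n := n) m k (D (F := F) R n m w)) =
      proj (F := F) R n m k₀ (TG (F := F) R (n := n) m k (eMap (F := F) R n m j₁ (cf R (D (F := F) R n m w) j₁))) := by
  conv_lhs => rw [← sum_eMap_cf R (D (F := F) R n m w)]
  rw [map_sum, map_sum, Finset.sum_eq_single j₁]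
  · intro j _ hj
    rw [← ModuleCat.comp_apply, ← ModuleCat.comp_apply, eMap_comp_TG_comp_proj R k]
    · simp
    · intro h
      exact hj ((Equiv.swap k.castSucc k.succ).injective (h.trans hj₁.symm))
  · exact fun h => absurd (Finset.mem_univ j₁) h

/-- `proj_{k+1} (TG (Eᵏ)_* y) = (Eᵏ⁺¹)_* y` seen in the horn pair. [folklore] -/
theorem proj_TG_eMap_castSucc {m : ℕ} (k : Fin (m + 1)) (y : Amod (F := F) R n m) :
    proj (F := F) R n m k.succ (TG (F := F) R (n := n) m k (eMap (F := F) R n m k.castSucc y)) = eHorn (F := F) R n m k.succ y := by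
  rw [← ModuleCat.comp_apply, ← ModuleCat.comp_apply, eMap_castSucc_comp_TG_assoc, eMap_comp_proj_self]

/-- `proj₀ (TG_{(k+1 k+2)} (E⁰)_* y) = (E⁰)_* (T_{(k k+1)} y)` in the horn pair. [folklore] -/
theorem proj_TG_eMap_zero_succ {m : ℕ} (k : Fin (m + 1)) (y : Amod (F := F) R n (m + 1)) :
    proj (F := F) R n (m + 1) 0 (TG (F := F) R (n := n) (m + 1) k.succ (eMap (F := F) R n (m + 1) 0 y)) =
      eHorn (F := F) R n (m + 1) 0 (T (F := F) R m k (n + (m + 1)) y) := by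
  rw [← ModuleCat.comp_apply, ← ModuleCat.comp_apply, eMap_zero_comp_TG_succ_assoc, eMap_comp_proj_self,
    ModuleCat.comp_apply]

/-- `proj_last (TG_{(0 1)} (E^last)_* y) = (E^last)_* (T_{(0 1)} y)` in the horn pair. [folklore] -/
theorem proj_TG_eMap_last_zero {m : ℕ} (y : Amod (F := F) R n (m + 1)) :
    proj (F := F) R n (m + 1) (Fin.last (m + 2)) (TG (F := F) R (n := n) (m + 1) 0 (eMap (F := F) R n (m + 1) (Fin.last (m + 2)) y)) =
      eHorn (F := F) R n (m + 1) (Fin.last (m + 2)) (T (F := F) R m 0 (n + (m + 1)) y) := by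
  rw [← ModuleCat.comp_apply, ← ModuleCat.comp_apply, eMap_last_comp_TG_zero_assoc, eMap_comp_proj_self,
    ModuleCat.comp_apply]

/-- **The base relation** on `Δ¹`: the two face components of `D₀ w` are opposite,
`cf (D₀ w) 1 = -Ξ₀ w` (from `∂ ≫ incl = 0` and the homotopy between the two vertex inclusions).
[folklore] -/
theorem cf_D_one_base (w : singularHomology R R F n) : cf R (D (F := F) R n 0 w) 1 = -Ξ F R 0 n w := by
  -- `incl (D w) = 0`
  have h0 : relativeSingularHomology.map R R (⟨Subtype.val, continuous_subtype_val⟩ : C(↥(bd F 1), StdSimplex 1 × F))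
      (mapsTo_val_preimage (bd F 1) (sk F 0)) (n + 0) (D (F := F) R n 0 w) = 0 := by
    rw [← ModuleCat.comp_apply, Category.assoc, relativeSingularHomology.tripleδ_comp_map R R (sk_subset_bd (F := F) 0),
      comp_zero]
    rfl
  -- the two vertex inclusions `ιⱼ = val ∘ Eʲ : (Δ⁰ × F, ∂) → (Δ¹ × F, sk)`
  have hsk : ∀ x : StdSimplex 1 × F, x ∉ sk F 0 := fun x hx => by
    rw [mem_sk_iff] at hx
    exact absurd hx (by have := Finset.card_pos.2 (StdSimplexCW.support_nonempty x.1); omega)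
  have hbd : ∀ x : StdSimplex 0 × F, x ∉ bd F 0 := fun x hx => (isEmpty_bd_zero (F := F)).false ⟨x, hx⟩
  let ι : Fin 2 → C(StdSimplex 0 × F, StdSimplex 1 × F) := fun j =>
    (⟨Subtype.val, continuous_subtype_val⟩ : C(↥(bd F 1), StdSimplex 1 × F)).comp (E F j)
  have hι : ∀ j, MapsTo (ι j) (bd F 0) (sk F 0) := fun j x hx => absurd hx (hbd x)
  have hιeq : ∀ j, eMap (F := F) R n 0 j ≫ relativeSingularHomology.map R R
      (⟨Subtype.val, continuous_subtype_val⟩ : C(↥(bd F 1), StdSimplex 1 × F))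
      (mapsTo_val_preimage (bd F 1) (sk F 0)) (n + 0) = relativeSingularHomology.map R R (ι j) (hι j) (n + 0) := fun j => by
    rw [← relativeSingularHomology.map_comp]
  -- `ι₀ ≃ ι₁`
  let Hh : ContinuousMap.Homotopy (ι 0) (ι 1) :=
    { toFun := fun q => (⟨(1 - (q.1 : ℝ)) • ((stdFace 0 q.2.1 : StdSimplex 1) : Fin 2 → ℝ) +
          (q.1 : ℝ) • ((stdFace 1 q.2.1 : StdSimplex 1) : Fin 2 → ℝ),
          (convex_stdSimplex ℝ (Fin 2)) (stdFace 0 q.2.1).2 (stdFace 1 q.2.1).2 (by linarith [q.1.2.2]) q.1.2.1 (by ring)⟩,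
          q.2.2)
      continuous_toFun := by
        refine (Continuous.subtype_mk ?_ _).prodMk (continuous_snd.comp continuous_snd)
        exact ((continuous_const.sub (continuous_subtype_val.comp continuous_fst)).smul
          (continuous_subtype_val.comp ((stdFace 0).continuous.comp (continuous_fst.comp continuous_snd)))).add
          ((continuous_subtype_val.comp continuous_fst).smul
            (continuous_subtype_val.comp ((stdFace 1).continuous.comp (continuous_fst.comp continuous_snd))))
      map_zero_left := fun x => by
        refine Prod.ext (Subtype.ext ?_) rfl
        show (1 - ((0 : I) : ℝ)) • _ + ((0 : I) : ℝ) • _ = _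
        rw [show ((0 : I) : ℝ) = 0 from rfl, sub_zero, one_smul, zero_smul, add_zero]
        rfl
      map_one_left := fun x => by
        refine Prod.ext (Subtype.ext ?_) rfl
        show (1 - ((1 : I) : ℝ)) • _ + ((1 : I) : ℝ) • _ = _
        rw [show ((1 : I) : ℝ) = 1 from rfl, sub_self, zero_smul, one_smul, zero_add]
        rfl }
  have hhom : relativeSingularHomology.map R R (ι 0) (hι 0) (n + 0) = relativeSingularHomology.map R R (ι 1) (hι 1) (n + 0) :=
    relativeSingularHomology.map_eq_of_homotopic_holds R R (hι 0) (hι 1) Hh (fun tx htx => absurd htx (hbd tx.2)) (n + 0)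
  -- `ι₀` has the left inverse `r (z, v) = (pt, v)`
  let r : C(StdSimplex 1 × F, StdSimplex 0 × F) := ⟨fun x => (default, x.2), continuous_const.prodMk continuous_snd⟩
  have hr : MapsTo r (sk F 0) (bd F 0) := fun x hx => absurd hx (hsk x)
  have hrι : r.comp (ι 0) = ContinuousMap.id _ :=
    ContinuousMap.ext fun x => Prod.ext (Subsingleton.elim _ _) rfl
  have hmono : Mono (relativeSingularHomology.map R R (ι 0) (hι 0) (n + 0)) := by
    haveI : Mono (relativeSingularHomology.map R R (ι 0) (hι 0) (n + 0) ≫ relativeSingularHomology.map R R r hr (n + 0)) := by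
      rw [← relativeSingularHomology.map_comp, relativeSingularHomology.map_congr R R hrι _ (mapsTo_id _) (n + 0),
        relativeSingularHomology.map_id]
      infer_instance
    exact mono_of_mono _ (relativeSingularHomology.map R R r hr (n + 0))
  -- assemble: `ι₀_* (y 0 + y 1) = 0`
  have hsum := congrArg (relativeSingularHomology.map R R (⟨Subtype.val, continuous_subtype_val⟩ : C(↥(bd F 1), StdSimplex 1 × F))
      (mapsTo_val_preimage (bd F 1) (sk F 0)) (n + 0)) (sum_eMap_cf R (D (F := F) R n 0 w))
  rw [h0, map_sum, Fin.sum_univ_two, ← ModuleCat.comp_apply, ← ModuleCat.comp_apply, hιeq, hιeq, ← hhom,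
    ← map_add] at hsum
  have hzero : cf R (D (F := F) R n 0 w) 0 + cf R (D (F := F) R n 0 w) 1 = 0 :=
    (ModuleCat.mono_iff_injective _).1 hmono (by rw [hsum, map_zero])
  rw [cf_D_zero] at hzero
  exact eq_neg_of_add_eq_zero_right hzero

/-- Alternating signs from the relations `y (k+1) = - y k`. [folklore] -/
theorem eq_pow_smul_of_succ_eq_neg {M : Type*} [AddCommGroup M] [Module R M] {m : ℕ} (y : Fin (m + 2) → M)
    (h : ∀ k : Fin (m + 1), y k.succ = -y k.castSucc) (j : Fin (m + 2)) : y j = ((-1 : R) ^ (j : ℕ)) • y 0 := by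
  induction j using Fin.induction with
  | zero => simp
  | succ i ih =>
    rw [h i, ih, Fin.val_succ, pow_succ, mul_comm, ← smul_smul, neg_one_smul]
    rfl

/-- **The boundary formula on `Δ¹`**: `cf (D₀ w) j = (-1)ʲ Ξ₀ w`. [folklore] -/
theorem cf_D_base (w : singularHomology R R F n) (j : Fin 2) :
    cf R (D (F := F) R n 0 w) j = ((-1 : R) ^ (j : ℕ)) • Ξ F R 0 n w := by
  rw [← cf_D_zero (F := F) R 0 w]
  refine eq_pow_smul_of_succ_eq_neg R _ (fun k => ?_) j
  obtain rfl : k = 0 := Fin.eq_zero k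
  show cf R (D (F := F) R n 0 w) 1 = -cf R (D (F := F) R n 0 w) 0
  rw [cf_D_one_base, cf_D_zero]

/-- **Transpositions act by `-1` on `Ξ₁`** (base of the induction). [folklore] -/
theorem T_Ξ_base (k : Fin 1) (w : singularHomology R R F n) :
    T (F := F) R 0 k (n + 1) (Ξ F R 1 n w) = -Ξ F R 1 n w := by
  obtain rfl : k = 0 := Fin.eq_zero k
  haveI := isIso_map_E_horn (F := F) R (m := 0) 1 (n + 0)
  have hw : twist (F := F) R 0 0 w = -w := by
    apply eq_of_proj_D_eq (F := F) R (m := 0) (0 : Fin 1).succ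
    rw [D_twist, proj_TG_D (F := F) R 0 0 (0 : Fin 1).succ (0 : Fin 1).castSucc (Equiv.swap_apply_left _ _) w,
      proj_TG_eMap_castSucc, proj_eq_eHorn_cf, cf_D_base, cf_D_base]
    simp
  rw [← Ξ_twist, hw, map_neg]

/-- **The inductive step**: if the transpositions of `Δᵐ⁺¹` act by `-1` on `Ξₘ₊₁`, then so do those of
`Δᵐ⁺²` on `Ξₘ₊₂`, and the face components of `D_{m+1} w` alternate: `cf (D w) j = (-1)ʲ Ξₘ₊₁ w`. [folklore] -/
theorem step (m : ℕ) (ih : ∀ (k : Fin (m + 1)) (w : singularHomology R R F n),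
      T (F := F) R m k (n + (m + 1)) (Ξ F R (m + 1) n w) = -Ξ F R (m + 1) n w) :
    (∀ (k : Fin (m + 2)) (w : singularHomology R R F n),
      T (F := F) R (m + 1) k (n + (m + 2)) (Ξ F R (m + 2) n w) = -Ξ F R (m + 2) n w) ∧
    ∀ (w : singularHomology R R F n) (j : Fin (m + 3)),
      cf R (D (F := F) R n (m + 1) w) j = ((-1 : R) ^ (j : ℕ)) • Ξ F R (m + 1) n w := by
  -- every transposed class is `-w`
  have htw : ∀ (k : Fin (m + 2)) (w : singularHomology R R F n), twist (F := F) R (m + 1) k w = -w := by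
    intro k w
    haveI := isIso_Ξ (F := F) R (m + 1) n
    induction k using Fin.cases with
    | zero =>
      -- compare at the last face
      have hlast0 : Fin.last (m + 2) ≠ (0 : Fin (m + 2)).castSucc := fun h => by
        rw [Fin.ext_iff] at h; simp at h
      have hlast1 : Fin.last (m + 2) ≠ (0 : Fin (m + 2)).succ := fun h => by
        rw [Fin.ext_iff] at h; simp at h
      apply eq_of_proj_D_eq (F := F) R (m := m + 1) (Fin.last (m + 2))
      rw [D_twist, proj_TG_D (F := F) R (m + 1) 0 (Fin.last (m + 2)) (Fin.last (m + 2))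
        (Equiv.swap_apply_of_ne_of_ne hlast0 hlast1) w, proj_TG_eMap_last_zero]
      -- `y last = Ξ v`, and `T (Ξ v) = -Ξ v`
      set v := inv (Ξ F R (m + 1) n) (cf R (D (F := F) R n (m + 1) w) (Fin.last (m + 2))) with hv
      have hyv : cf R (D (F := F) R n (m + 1) w) (Fin.last (m + 2)) = Ξ F R (m + 1) n v := by
        rw [hv, ← ModuleCat.comp_apply, IsIso.inv_hom_id, ModuleCat.id_apply]
      rw [hyv, ih 0 v, ← hyv, proj_eq_eHorn_cf, cf_D_neg, Pi.neg_apply]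
    | succ k' =>
      -- compare at the `0`-th face
      have h00 : (0 : Fin (m + 3)) ≠ k'.succ.castSucc := fun h => by
        rw [Fin.ext_iff] at h; simp at h
      have h01 : (0 : Fin (m + 3)) ≠ k'.succ.succ := fun h => by
        rw [Fin.ext_iff] at h; simp at h
      apply eq_of_proj_D_eq (F := F) R (m := m + 1) 0
      rw [D_twist, proj_TG_D (F := F) R (m + 1) k'.succ 0 0 (Equiv.swap_apply_of_ne_of_ne h00 h01) w,
        proj_TG_eMap_zero_succ, cf_D_zero, ih k' w, proj_eq_eHorn_cf, cf_D_neg, Pi.neg_apply, cf_D_zero]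
  refine ⟨fun k w => by rw [← Ξ_twist, htw, map_neg], fun w => ?_⟩
  -- the relations `y (k+1) = - y k`
  have hrel : ∀ k : Fin (m + 2), cf R (D (F := F) R n (m + 1) w) k.succ = -cf R (D (F := F) R n (m + 1) w) k.castSucc := by
    intro k
    haveI := isIso_map_E_horn (F := F) R (m := m + 1) k.succ (n + (m + 1))
    apply (ModuleCat.mono_iff_injective (eHorn (F := F) R n (m + 1) k.succ)).1 inferInstance
    have h1 := proj_TG_D (F := F) R (m + 1) k k.succ k.castSucc (Equiv.swap_apply_left _ _) w
    rw [← D_twist, htw, proj_TG_eMap_castSucc, proj_eq_eHorn_cf, cf_D_neg, Pi.neg_apply] at h1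
    rw [map_neg, ← h1, map_neg, neg_neg]
  intro j
  rw [← cf_D_zero (F := F) R (m + 1) w]
  exact eq_pow_smul_of_succ_eq_neg R _ hrel j

/-- **Transpositions of the vertices act by `-1`** on the Künneth classes: for every `m`, every
`k`, `((k k+1) × 𝟙)_* ∘ Ξₘ₊₁ = -Ξₘ₊₁`. [folklore] -/
theorem T_Ξ : ∀ (m : ℕ) (k : Fin (m + 1)) (w : singularHomology R R F n),
    T (F := F) R m k (n + (m + 1)) (Ξ F R (m + 1) n w) = -Ξ F R (m + 1) n w
  | 0 => T_Ξ_base R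
  | m + 1 => (step R m (T_Ξ m)).1

/-- The face components of `D_m w` alternate: `cf (D_m w) j = (-1)ʲ Ξₘ w`. [folklore] -/
theorem cf_D : ∀ (m : ℕ) (w : singularHomology R R F n) (j : Fin (m + 2)),
    cf R (D (F := F) R n m w) j = ((-1 : R) ^ (j : ℕ)) • Ξ F R m n w
  | 0 => cf_D_base R
  | m + 1 => (step R m (T_Ξ R m)).2

/-- **The boundary formula** (Spanier's `∂(ξₛ × w) = ∑ᵢ (-1)ⁱ (eⁱ × 1)_*(ξₛ₋₁ × w)`, cross-product-free):
`∂_sk (Ξₘ₊₁ w) = ∑ⱼ (-1)ʲ (Eʲ)_* (Ξₘ w)` in `H_{n+m}((∂Δᵐ⁺¹, (Δᵐ⁺¹)ᵐ⁻¹) × F)`.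
[cite: Spanier1981, Ch. 9 Sec. 2 Lemma 14 (proof) and Thm. 15 (b) (proof)] -/
theorem boundary_formula (m : ℕ) (w : singularHomology R R F n) :
    δsk (F := F) R n m (Ξ F R (m + 1) n w) = ∑ j : Fin (m + 2), ((-1 : R) ^ (j : ℕ)) • eMap (F := F) R n m j (Ξ F R m n w) := by
  have h := sum_eMap_cf R (D (F := F) R n m w)
  change D (F := F) R n m w = _
  rw [← h]
  refine Finset.sum_congr rfl fun j _ => ?_
  rw [cf_D R m w j, map_smul]

end Induction

end BoundaryFormula

end SimplexTimesFibre

end Literature.AlgebraicTopology.Homotopy
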